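import Mathlib
import Literature.MathematicalPhysics.QuantumFieldTheory.MagnenRivasseauSeneor1993.MRS93BackgroundGaugeFixing
import HarnessLib

/-!
# Magnen–Rivasseau–Sénéor (CMP 155, 1993): (II.55), (II.66), (II.70)–(II.77) pp.343–346 — the re-integration over
# the ghost variable `γ′` defining `K_{ρ₂}(A′, γ)` and `K_{ρ,ρ₂}(A′, γ)`, typed AS PRINTED: (II.66) obtained from
# (II.55) under the integral sign; (II.70); the completion of the square (II.71)–(II.73) PROVED in finite dimensions
# with the omitted transpositions restored (`γ″`, `Ω`, `Ω ≤ 0`, the re-integration identity); the operator algebra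
# (II.74) PROVED in any real operator algebra, (II.75) and (II.76) as definitions, (II.77) PROVED in the print's
# commuting («zero external momenta») regime; the prefactor: `Z(Q) = (2π)^{n/2}(det Q)^{−1/2}` PROVED, so the printed
# `(det (ζU²+Γ⁻¹)/Γ⁻¹)^{−1/2}` IS the ratio of Gaussian normalisations, and `det((ζU²+Γ⁻¹)/Γ⁻¹) = det(1 + ζΓU²)` PROVED

statement-level skeleton of published definitions with citation tags; bookkeeping proved; nothing here is a claim
about the Yang–Mills mass gap, about continuum Yang–Mills on `T⁴` without infrared cutoff, or about the Clay problem —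
and nothing of Magnen–Rivasseau–Sénéor's analysis (expansions, bounds, limits) is asserted or formalised

**Citation header (reproduction of PUBLISHED work).** J. Magnen, V. Rivasseau, R. Sénéor, *Construction of YM₄ with
an infrared cutoff*, Commun. Math. Phys. **155** (1993) 325–383 [MagnenRivasseauSeneor1993], Sect. II.D pp.343–346:
(II.55) p.343 tl.15–17; (II.66) p.344 tl.13–14; (II.70) p.344 tl.23–29; (II.71)–(II.73) p.345 tl.2–13; the determinant
sentence p.345 tl.14–21; (II.74) p.345 tl.25–29; (II.75) p.346 tl.2–6; (II.76) p.346 tl.7; (II.77) p.346 tl.13–24. Loci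
`p.NNN tl.nn` = journal page / text-layer line of the held scan `paper:magnen1993-cmp155-mrs-ym4-infrared-cutoff` (PDF
page = journal page − 324); every display was read on the decoded page IMAGES (renders of record
`run/shared/lean/pub/lit-balaban/inprint/lit-balaban-p14/renders-cmp155/p19_full_s6.png` … `p22_full_s6.png`; 2× crops
`p19_crop_r1900-2600_s2.png`, `p20_crop_r2150-3000_s2.png`, `p20_crop_r3900-5200_s2.png`, `p21_crop_r450-2500_s2.png`,
`p21_crop_r2500-5400_s2.png`, `p22_crop_r450-2600_s2.png`, `p22_crop_r2600-5000_s2.png` in the gen-6 seat folder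
`run/shared/lean/pub/pub-balaban-gaps/pub-balaban-gaps-mrs-lit-1/g6/renders/`). Cell pub-balaban-gaps, track G3, seat
mrs-lit-1 (gen 6); companion prose `run/shared/lean/pub/pub-balaban-gaps/g3/MRS-AS-PRINTED.md` §2, §5. Builds on
`…MRS93BackgroundGaugeFixing` (gen 5: `nablaB` (II.38), `nablaPrime` (II.50), `nablaRB` (II.62), `covDCoeff` (II.5),
`uOp` (II.68), `vOp` (II.69), `remS2`/(II.61)–(II.63), `sqNormBox`/`dotBox`/`sigmaCorr` (II.64)–(II.65), `Knorm` (II.37),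
`nablaRB_covD_eq_uOp_add_vOp` = (II.67), `nablaPrime_reexpand` = (II.61), `sqNormBox_add` = (II.64)) and, through it,
`…MRS93GaussianReferenceMeasures` (`GhostConfig`, `nu par ρ₂` = `dν_{ρ₂}`), `…MRS93AxialYMAction` (`coeffZ`, READING (P)).

**Why this file.** After gen 5 the seat record (§5 v22) listed as the untyped links of the `K_{ρ,ρ₂}` derivation:
«(II.55) and (II.66) (the dν_{ρ₂}(γ′)-integrals — typable like `Knorm`, not done), W (II.70) and UᵗU («we omit the
necessary transpositions»), (II.71)–(II.76) (Gaussian regrouping)». This file types them, so that of the bare ansatz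
(II.78) the factor `[K_{ρ,ρ₂}(A′,γ)]⁻¹` — «an analogue of K_{ρ₂} … its precise definition is somewhat complicated»
(p.340 tl.25–27) — is now typed modulo declared readings, leaving `χ_LFR` (the outcome of the expansions) and `G(A′,γ)`
(II.45) as the only untyped factors of (II.78).

**What the paper prints (verbatim, from the page images).**
* p.343 tl.15–17: *«We have first to express K_{ρ₂}(A) in terms of A′ and γ: K_{ρ₂}(A′,γ) = ∫dν_{ρ₂}(γ′)
  e^{−Σ_i((λ_i^t)^{1/2+ε₂/4}γ′^i)^N} × e^{−(ζ/2)(∇_B((A′_s)^{−γ,2}+R_μ(A_s,γ),(B′_l)^{−rot γ,2}+R′_μ(B_l,γ),γ′,2))²} (II.55)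
  (see (II.37) for definition of our notation ∇_B(A,B,γ,2)).»* [the damping exponent prints `ε₂/4` here and `2ε₂` in
  (II.37), (II.66), (II.73), (II.76) — recorded, immaterial under READING (Y)].
* p.344 tl.13–14: *«With these notations: K_{ρ₂}(A′,γ) = ∫dν_{ρ₂}(γ′) e^{−Σ_i(λ^{1/2+2ε₂}γ′^i)^N} ×
  e^{−(ζ/2)(∇_{RB,γ′−γ}·(A′_s+D(A′_s)(γ′−γ)))²} e^{−(ζ/2)Σ(A′,γ,γ′)}. (II.66)»*
* p.344 tl.23–29: *«Again we write (U + V + ∇_{RB,γ′−γ}·A′_s)² = (U + ∇_{RB,γ′−γ}·A′_s)² + W, W ≡ 2V·(U + ∇_{RB,γ′−γ}·A′_s)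
  + V² (II.70) (to simplify these formulas we write them like squares instead of scalar products, and we omit the
  necessary transpositions of operators, which are straightforward). Since V is small (with a factor λ²), we can treat
  Σ + W in the integral over γ′ as a complicated interaction, and we group together the measure dν_{ρ₂}(γ′) with the
  main quadratic piece (ζ/2)⟨γ′ − γ, UᵗʳU(γ′ − γ)⟩. Again we write U² for UᵗʳU, etc.»*; tl.30–33: *«If the measure
  dν_{ρ₂}(γ′) had been translation invariant we would have as a main piece a Gaussian integral over γ′ − γ. This is not
  exactly the case, but by our condition ε₂ ≫ ε₁ it will be approximately true in the small field region …»*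
* p.345 tl.2–13: *«Therefore we define a new Gaussian variable γ″ which has propagator (ζU² + Γ⁻¹)⁻¹ and which is
  defined by: γ″ = γ′ − γ + (ζU(∇_{RB,γ′−γ}·A′_s) + Γ⁻¹γ)/(ζU² + Γ⁻¹). (II.71) We define also Ω ≡ (ζU(∇_{RB,γ′−γ}·A′_s) +
  Γ⁻¹γ)²/(ζU² + Γ⁻¹) − ζ(∇_{RB,γ′−γ}·A′_2)² − γΓ⁻¹γ. (II.72) [«A′_2» sic, for A′_s] We see that Ω is small as Γ⁻¹ when
  Γ⁻¹ → 0. This is the reason for which we can treat it as an interaction … Now we obtain, rewriting everything in terms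
  of γ″, K_{ρ₂}(A′,γ) = (det (ζU² + Γ⁻¹)/Γ⁻¹)^{−1/2} ∫dπ_{ρ₂}(γ″) × e^{−Σ_i(λ^{1/2+2ε₂}κ^i(γ′(γ″,γ)))^N}
  e^{−(ζ/2)(Σ+W+Ω)(A′,γ,γ′(γ,γ″))} (II.73) by completing the square.»*; tl.14–17: *«The determinant (det (ζU²+Γ⁻¹)/Γ⁻¹)^{1/2}
  = (det(1 + ζΓU²))^{1/2} which appears in K_{ρ₂}(A)⁻¹ is the analogue of the Fadeev-Popov determinant (up to the
  constant normalization det Γ⁻¹).»*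
* p.345 tl.25–29: *«We are at last in the position to define K_{ρ,ρ₂}. We write Δ for the ordinary Laplacian and
  ζUᵗʳU + Γ⁻¹ = (ζΔ² + Γ⁻¹)(1 − λ (ζΔ/(ζΔ²+Γ⁻¹)) × (∂[A′_s,·] + Σ_j[κ_j∗B′_l, κ^j∗∂·]) − λ (1/(ζΔ²+Γ⁻¹))(∂[A′_s,·] +
  Σ_j[κ_j∗B′_l, κ^j∗∂·]) ζΔ + λ² (ζ/(ζΔ²+Γ⁻¹))(∂[A′_s,·] + Σ_j[κ_j∗B′_l, κ^j∗∂·])²), (II.74)»*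
* p.346 tl.2–7: *«and we change this operator into: (ζUᵗʳU + Γ⁻¹)_ρ ≡ (ζΔ + Γ⁻¹)(1 − λκ_ρ(p)(ζΔ/(ζΔ²+Γ⁻¹)) × (∂[A′_s,·] +
  Σ_j[…]) − λ (κ_ρ(p)/(ζΔ²+Γ⁻¹))(∂[A′_s,·] + Σ_j[…]) ζΔ + λ² (ζκ_ρ²(p)/(ζΔ²+Γ⁻¹))(∂[A′_s,·] + Σ_j[…])²). (II.75) [leading
  factor «(ζΔ + Γ⁻¹)» sic; (II.74) has (ζΔ² + Γ⁻¹)] We define K_{ρ,ρ₂}(A′,γ) = (det (ζUᵗʳU+Γ⁻¹)_ρ/Γ⁻¹)^{−1/2} ∫dπ_{ρ₂}(γ″)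
  × e^{−Σ_i((λ_i^t)^{1/2+2ε₂}κ^i(γ′(γ″,γ)))^N} e^{−(ζ/2)[Σ+W+Ω]}. (II.76)»*
* p.346 tl.8–24: *«In this formula the remaining functional integral is close to one since Σ + W + Ω is a small
  interaction, as explained above. The main piece is the determinant which is nothing but the ordinary Fadeev-Popov
  term. … at zero external momenta for A′, the only contribution of K_{ρ,ρ₂} to the counterterm λ⁴A′⁴ (see below) comes
  from the ordinary Fadeev-Popov determinant. At this order we obtain therefore as only contribution (taking out
  constant factors, in particular a global power of ζ) (det Δ²(1 − λκ_ρ(p)Δ⁻¹(∂[A′_s,·] + Σ_j[…]) − λκ_ρ(p)Δ⁻²(∂[A′_s,·] +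
  Σ_j[…])Δ + λ (κ_ρ²(p)/Δ²)(∂[A′_s,·] + Σ_j[…])²))^{1/2} = det|Δ − λκ_ρ(p)(∂[A′_s,·] + Σ_j[κ_j∗B′_l, κ^j∗∂·])| (II.77)
  [«+ λ κ_ρ²(p)/Δ²» sic, for λ²] which is the same as the ordinary Fadeev-Popov determinant with a cutoff on the ghosts
  propagator of the desired simple form, and a ghost-ghost-field vertex which is the ordinary coupling to the full
  field A′ at least at zero momentum external field A′.»*

**Edition v1.1 (gen 6).** §3/§5/§6: the matrix `U` of (II.68)/(II.70)–(II.73) is RECTANGULAR (`U : Matrix κ ι ℝ`,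
columns = the ghost-window coordinates `ι` of `γ′`, rows = the value coordinates `κ` of `Uη`, e.g. pairs `(k, a)`), and
the source term `c = ∇_{RB,γ′−γ}·A′_s : κ → ℝ` lives in the value space — as in print, where `U` maps the ghost field to
a vector field; v1 had the square special case `κ = ι`. All statements and proofs are otherwise unchanged
(`Omega_eq_zero_of_noPropagator`, which inverts `U`, stays square).
READING (FD) itself — «`dν_{ρ₂}` restricted to finitely many window coordinates IS the normalised Gaussian `gaussExpect`
with `Γ⁻¹ = diag(Γ_{ρ₂}⁻¹)`» — is PROVED for the tree's `nu`/`muZero` on every finite window in the sibling leaf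
`…MRS93WindowGaussian` (gen 6; `integral_nu_window`, `integral_nu_window_rep`), which imports this file.

**What is typed here (definitions with bodies; bookkeeping kernel-checked, zero `sorry`, zero named facts).**
* §1 **(II.55)/(II.66)** in the tree's momentum-space vocabulary: `k55Integrand`/`Krho2Prime` = (II.55) against
  `nu par ρ₂` for GENERIC coefficient functions `Ainv`, `Binv` standing for `(A′_s)^{−γ,2} + R_μ(A_s,γ)`,
  `(B′_l)^{−rot γ,2} + R′_μ(B_l,γ)`; `Knorm_eq_Krho2Prime` ((II.55) IS (II.37) `Knorm` re-expressed — `rfl` — which is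
  what (II.51)/(II.52) say); `k66Integrand`/`Krho2Prime66` = (II.66) with `N = ∇_{RB,γ′−γ}·(A′_s + D(A′_s)(γ′−γ))`
  (`mainForm`, `shiftedField`, `etaCoeff` = coefficients of `γ′ − γ`, `etaCoeff_eq`); PROVED
  **`k55Integrand_eq_k66Integrand`** and **`Krho2Prime_eq_Krho2Prime66`**: granted the pointwise re-expansions (II.56),
  (II.59) of the `γ′`-transformed arguments (PROVED on values in `…InfinitesimalGauge` §8; hypotheses on the coefficient
  families here, READING (Z)), (II.55) = (II.66) EXACTLY as `dν_{ρ₂}(γ′)`-integrals, by (II.61) (corrected `S″`) and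
  (II.64).
* §2 **(II.67) inside (II.66) and (II.70)**: `nablaRB_add_field` (∇_{RB} additive in the field), **`mainForm_eq`**
  (`∇_{RB,η}·(A′_s + D(A′_s)η) = ∇_{RB,η}·A′_s + (U + V)η`, EXACT), `wCorr` = `W ≡ 2V·(U + ∇_{RB}·A′_s) + V²` (the
  (II.65)-shape `sigmaCorr` of the pair), **`sqNormBox_uv`** = (II.70) PROVED EXACTLY, and **`sqNormBox_mainForm`**: the
  main exponent of (II.66) IS `(U(γ′−γ) + ∇_{RB,γ′−γ}·A′_s)² + W`.
* §3 **(II.71)–(II.73), completing the square — PROVED in finite dimensions (READING (FD))**, sub-namespace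
  `GhostGaussian`, for real matrices on a finite index type (the window coordinates of the ghosts): `csMat` = `ζU² + Γ⁻¹`
  (`ζUᵀU + Γ⁻¹`), `csVec` = `ζU(∇·A′_s) + Γ⁻¹γ` (`ζUᵀc + Γ⁻¹γ`), **`gammaPP`** = (II.71) `γ″`, **`Omega`** = (II.72),
  `csExponent` = `γ′ᵀΓ⁻¹γ′ + ζ‖U(γ′−γ)+c‖²`; PROVED **`csExponent_eq`** (`E(γ′) = γ″ᵀ(ζU²+Γ⁻¹)γ″ − Ω` for symmetric `Γ⁻¹`
  and invertible `ζU²+Γ⁻¹`), `posDef_csMat`/`isUnit_det_csMat` (`ζ ≥ 0`, `Γ⁻¹ ≻ 0`), **`Omega_nonpos`** (`Ω ≤ 0`),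
  **`Omega_eq_zero_of_noPropagator`** (`Ω = 0` at `Γ⁻¹ = 0`, `U` invertible — «Ω is small as Γ⁻¹ when Γ⁻¹ → 0»),
  **`integral_completing_square`** (the re-integration identity behind (II.73), Lebesgue form, ANY weight `F`:
  `∫dγ′ e^{−½E(γ′)}F(γ′) = e^{Ω/2}∫dγ″ e^{−½γ″ᵀ(ζU²+Γ⁻¹)γ″}F(γ′(γ″,γ))`, translation invariance), `gaussZ`, `gaussExpect`
  (normalised Gaussian expectations `∫dν_Γ`, `∫dπ`), **`gaussExpect_completing_square`** ((II.73) in normalised form with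
  the prefactor `Z(ζU²+Γ⁻¹)/Z(Γ⁻¹)`), **`det_csMat_mul_propagator`** (`det((ζU²+Γ⁻¹)Γ) = det(1 + ζΓU²)`, p.345 tl.14–15,
  by `det(1 + AB) = det(1 + BA)`).
* §4 **(II.74)/(II.75)/(II.77)**, sub-namespace `FPOperator`: **`opExpand`** = (II.74) PROVED in any real algebra with
  `U = Δ − λX` («U² for UᵗʳU» read literally; fractions `Y/(ζΔ²+Γ⁻¹)` = `P⁻¹Y` where printed; NO commutation of `Δ`
  with `X` used); **`opRho`** = (II.75) (definition, `κ_ρ` leftmost in each term as printed; leading factor typed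
  `ζΔ² + Γ⁻¹`), `opRho_one` ((II.75) at `κ_ρ ≡ 1` IS (II.74)), `opRho_zero_coupling`; `opRho_comm` ((II.75) =
  `ζ(Δ − λκ_ρX)² + Γ⁻¹` for commuting symbols); **`fpSquare_comm`**/`sqrt_sq_eq_abs_det` and, for window matrices with
  `κ_ρ`, `Δ`, `X` pairwise commuting (all momentum multipliers — the print's «zero external momenta for A′»),
  **`GhostGaussian.sqrt_det_fpSquare`** = (II.77) PROVED: `(det Δ²(1 − λκΔ⁻¹X − λκΔ⁻²XΔ + λ²κ²Δ⁻²X²))^{1/2} = |det(Δ − λκX)|`.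
* §5 **(II.76)**: **`GhostGaussian.Krr Mρ Γinv G`** = `(det(Mρ/Γ⁻¹))^{−1/2} ∫dπ_{Mρ} G` (READING (FD); the remaining
  integrand `G` — damping × `e^{−(ζ/2)[Σ+W+Ω]}` in the variable `γ″` — a parameter whose pieces are typed in §1–§3 and
  in `…BackgroundGaugeFixing`), and **`Krr_csMat_eq`**: at `κ_ρ ≡ 1` and with `G = e^{Ω/2}F(γ′(γ″,γ))`, `K_{ρ,ρ₂}` IS the
  completed-square form (II.73) of `∫dν_Γ(γ′)e^{−(ζ/2)(U(γ′−γ)+c)²}F(γ′)`, granted the Gaussian value of the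
  normalisation ratio `Z(M)/Z(Γ⁻¹) = (det(M/Γ⁻¹))^{−1/2}` — which §6 PROVES: **`Krr_csMat_eq_of_posDef`** (`ζ ≥ 0`,
  `Γ⁻¹ ≻ 0`, no normalisation hypothesis left).
* §6 **The Gaussian normalisation, PROVED** (READING (FD)): `integral_comp_mulVec` (linear change of variables
  `∫g(Ly)dy = |det L|⁻¹∫g`, Mathlib's Lebesgue-under-linear-maps), `integral_exp_neg_half_dotProduct_self`
  (`∫e^{−½z·z}dz = (2π)^{n/2}`, Fubini + the one-dimensional Gaussian integral), **`gaussZ_eq`** (`Z(Q) =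
  (2π)^{n/2}/√det Q` for `Q ≻ 0`, via `Q = (√Q)²` by the continuous functional calculus, `det √Q = √det Q`), `gaussZ_pos`,
  **`gaussZ_ratio`** (`Z(ζU²+Γ⁻¹)/Z(Γ⁻¹) = (det (ζU²+Γ⁻¹)/Γ⁻¹)^{−1/2}` — the printed prefactor of (II.73)/(II.76), «the
  analogue of the Fadeev-Popov determinant (up to the constant normalization det Γ⁻¹)»).

**Readings (declared).** (P), (Z), (R″), (Y) of `…BackgroundGaugeFixing` (Parseval at unit volume; finite momentum
boxes; `λ_j^t` inside `Σ_j`, free `λ` elsewhere; the damping polynomial as a functional parameter `P ≥ 0`). (FD)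
FINITE-DIMENSIONAL GAUSSIAN: (II.71)–(II.73), (II.76) are statements about the Gaussian integral over the finitely many
window coordinates of `γ′`; they are typed and proved for an ARBITRARY symmetric (resp. positive-definite) real matrix
`Γ⁻¹` and an arbitrary real matrix `U` on a finite index type, with `∫dν_Γ`/`∫dπ` the normalised Gaussian expectations
`gaussExpect`; the identification of the tree's `nu par ρ₂` restricted to a window with such a Gaussian is NOT
re-proved here (its INDEPENDENT coordinates are the real/imaginary parts of `γ̃(p)` at the positive momenta of the
window — `nu` is realified, `γ̃(−p) = conj γ̃(p)` — with diagonal covariance `Γ_{ρ₂}(|p|)`, modes above `ρ₂` pinned; the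
print's `Γ⁻¹` presupposes `Γ_{ρ₂} > 0` on the modes integrated). (TR) TRANSPOSITIONS: «we omit the necessary transpositions of
operators» (p.344 tl.25–26) — restored as `Uᵀ` where completing the square requires them (`ζUᵀU`, `ζUᵀc`); in §4 «U²
for UᵗʳU» is read literally as printed. (CM) COMMUTING SYMBOLS: (II.75) = (II.74)∘(λ ↦ λκ_ρ) and (II.77) are exact for
commuting `κ_ρ(p)`, `Δ`, `X` — the print's own regime «at zero external momenta for A′» (p.346 tl.11–12, tl.22), where the
vertex is a momentum multiplier; typed with explicit `Commute` hypotheses / in a field.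

**As-printed precisions recorded (kernel-exhibited where an identity is at stake; none adjudicated, none affects the
argument).** (m) (II.75) prints its leading factor as «(ζΔ + Γ⁻¹)» where (II.74) one display earlier has `(ζΔ² + Γ⁻¹)`
(typed with `Δ²`; `opRho_zero_coupling`, `opRho_one`). (n) (II.77) prints «+ λ κ_ρ²(p)/Δ²(…)²» where the square
requires `λ²` (as in (II.75); typed `λ²`, `fpSquare_comm`). (o) completing the square with the printed `γ″` (II.71) and
`Ω` (II.72) yields the factor `e^{+Ω/2}` with `Ω ≤ 0` (`csExponent_eq`, `Omega_nonpos`); (II.73)/(II.76) carry `Ω` inside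
`e^{−(ζ/2)(Σ+W+Ω)}` («taking out constant factors» bookkeeping; `Ω` is in any case the small term the text describes,
`Omega_eq_zero_of_noPropagator`). (p) (II.55) prints the damping exponent `ε₂/4`, (II.37)/(II.66)/(II.73)/(II.76) `2ε₂`.
(q) (II.72) «A′_2» for `A′_s`. Earlier findings (k) (p.341 tl.20, missing λ) and (l) ((II.63) double-counted cross term)
are in `…InfinitesimalGauge` / `…BackgroundGaugeFixing`.

**Honest status / what is NOT claimed.** Typed: the displays (II.55), (II.66), (II.70)–(II.77) as definitions and
identities in the stated readings. NOT typed / NOT claimed: that `Σ + W + Ω` is small or that «the remaining functional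
integral is close to one»; the approximate statements p.345 tl.17–23 (`Γ⁻¹` «small as λ^{1/2ε₂}», `U(A′_s + B′_l) ≅ …`);
that `(ζUᵗʳU + Γ⁻¹)_ρ` of (II.75) defines a Gaussian measure (it need not be symmetric — the print presupposes it); the
link of (FD) to the tree's infinite-product `nu` (the window marginal of `dν_{ρ₂}` as a finite-dimensional Gaussian); anything about `χ_LFR`, `G(A′,γ)` (II.45), `CT_ρ`, Sect. III's use of (II.77), or the
normalisability of (II.78). Nothing here bears on Bałaban's papers; nothing is continuum YM₄ on `T⁴`, nothing lifts the
infrared cutoff, nothing is Clay.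
-/

noncomputable section

open MeasureTheory Finset Complex
open scoped NNReal ENNReal ComplexConjugate Matrix

namespace Literature.MathematicalPhysics.QuantumFieldTheory.MagnenRivasseauSeneor1993

namespace MainStatement

open Ansatz

variable (par : Parameters) (Nlow : ℕ → ℕ)

/-! ## §1 (II.55) and (II.66) p.343–344: `K_{ρ₂}(A′, γ)` as a `dν_{ρ₂}(γ′)`-integral; (II.66) follows from (II.55)
under the integral sign by (II.56)/(II.59), (II.61) and (II.64) -/

/-- Coefficient functions of a cut-off VECTOR field (`A′_s`, `B′_l`, …): `k ↦ μ ↦ a ↦ X̃^a_μ(k)` (READING (P) of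
`…AxialYMAction`). [cite: MagnenRivasseauSeneor1993, §II.A p.328 tl.12–15] -/
abbrev VCoeff : Type := (Fin 4 → ℤ) → Fin 4 → Fin 3 → ℂ

/-- Coefficient functions of a cut-off GHOST-TYPE (su(2)-valued scalar) field (`γ`, `γ′ − γ`, `∇·X`, …).
[cite: MagnenRivasseauSeneor1993, (II.36) p.339] -/
abbrev GCoeff : Type := (Fin 4 → ℤ) → Fin 3 → ℂ

/-- The coefficients of `γ′ − γ` for two `γ` configurations cut off at the window `Sγ` (in print `γ` is the variable
of (II.50)/(II.78), `γ′` the new integration variable of (II.55), p.343 tl.4–5).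
[cite: MagnenRivasseauSeneor1993, p.343 tl.4–5, (II.56) p.343] -/
def etaCoeff (Sγ : Finset Momentum) (γ γ' : GhostConfig) : GCoeff := gcoeffZ Sγ γ' - gcoeffZ Sγ γ

/-- `γ̃` is additive in the configuration … [cite: MagnenRivasseauSeneor1993, (II.36) p.339] -/
theorem gcoeffZ_sub (Sγ : Finset Momentum) (γ γ' : GhostConfig) :
    gcoeffZ Sγ (γ' - γ) = gcoeffZ Sγ γ' - gcoeffZ Sγ γ := by
  funext k a
  simp only [gcoeffZ, Pi.sub_apply]
  split_ifs
  · simp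
  · simp only [gcoeff, Pi.sub_apply, Complex.ofReal_sub]; ring
  · simp

/-- … so `η = γ̃′ − γ̃` IS the coefficient function of the configuration `γ′ − γ`.
[cite: MagnenRivasseauSeneor1993, p.343 tl.4–5] -/
theorem etaCoeff_eq (Sγ : Finset Momentum) (γ γ' : GhostConfig) :
    etaCoeff Sγ γ γ' = gcoeffZ Sγ (γ' - γ) := by
  rw [etaCoeff, gcoeffZ_sub]

/-- **The integrand of (II.55)**: `e^{−P(γ′)} e^{−(ζ/2)(∇_B(Ainv, Binv, γ′, 2))²}` for GENERIC coefficient functions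
`Ainv`, `Binv` — in print `Ainv = (A′_s)^{−γ,2} + R_μ(A_s, γ)` and `Binv = (B′_l)^{−rot γ,2} + R′_μ(B_l, γ)`, which by
(II.51)/(II.52) ARE `A_s`, `B_l` («We have first to express K_{ρ₂}(A) in terms of A′ and γ») — with `∇_B(·,·,γ′,2)` the
tree's (II.38) `nablaB` at the ghost `γ′`, the square in the Parseval reading (`sqNormBox` over `box4 T`), and the
damping factor `e^{−Σ_i((λ_i^t)^{1/2+ε₂/4}γ′^i)^N}` carried as `e^{−P(γ′)}` (READING (Y)).
[cite: MagnenRivasseauSeneor1993, (II.55) p.343 tl.16–17, (II.37)–(II.38) p.339] -/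
def k55Integrand (T : Finset (Fin 4 → ℤ)) (Sγ : Finset Momentum) (ρ₁ : ℕ) (lam : ℝ) (Ainv Binv : VCoeff)
    (P : GhostConfig → ℝ) (γ' : GhostConfig) : ℝ :=
  Real.exp (-(par.ζ / 2) * sqNormBox (box4 T) (nablaB par Nlow T ρ₁ lam Ainv Binv (gcoeffZ Sγ γ')) - P γ')

/-- **(II.55), `K_{ρ₂}(A′, γ) = ∫ dν_{ρ₂}(γ′) e^{−Σ_i((λ_i^t)^{1/2+ε₂/4}γ′^i)^N} e^{−(ζ/2)(∇_B((A′_s)^{−γ,2}+R_μ(A_s,γ),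
(B′_l)^{−rot γ,2}+R′_μ(B_l,γ), γ′, 2))²}`** against the tree's `dν_{ρ₂}` (`nu par ρ₂`), for generic `Ainv`, `Binv`.
[cite: MagnenRivasseauSeneor1993, (II.55) p.343 tl.16–17] -/
def Krho2Prime (T : Finset (Fin 4 → ℤ)) (Sγ : Finset Momentum) (ρ₁ ρ₂ : ℕ) (lam : ℝ) (Ainv Binv : VCoeff)
    (P : GhostConfig → ℝ) : ℝ :=
  ∫ γ', k55Integrand par Nlow T Sγ ρ₁ lam Ainv Binv P γ' ∂(nu par ρ₂)

/-- **(II.55) IS (II.37) re-expressed**: when `Ainv`, `Binv` are the coefficient functions of `A_s`, `B_l` (which is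
what (II.51)/(II.52) say of `(A′_s)^{−γ,2} + R_μ(A_s,γ)`, `(B′_l)^{−rot γ,2} + R′_μ(B_l,γ)`), `K_{ρ₂}(A′, γ)` of
(II.55) is LITERALLY `K_{ρ₂}(A_s, B_l)` of (II.37) (`Knorm`) — definitionally.
[cite: MagnenRivasseauSeneor1993, (II.55) p.343, (II.37) p.339, (II.51)–(II.52) p.343] -/
theorem Knorm_eq_Krho2Prime (S Sγ : Finset Momentum) (ρ₁ ρ₂ : ℕ) (lam : ℝ) (A B : Config)
    (P : GhostConfig → ℝ) :
    Knorm par Nlow S Sγ ρ₁ ρ₂ lam A B P =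
      Krho2Prime par Nlow (momentumBox S Sγ) Sγ ρ₁ ρ₂ lam (coeffZ S A) (coeffZ S B) P := rfl

/-- **The integrand of (II.66)**: `e^{−P(γ′)} e^{−(ζ/2)(∇_{RB,γ′−γ}·(A′_s + D(A′_s)(γ′−γ)))²} e^{−(ζ/2)Σ(A′,γ,γ′)}` for a
`γ′`-dependent ghost-type family `N(γ′)` (= `∇_{RB,γ′−γ}·(A′_s + D(A′_s)(γ′−γ))`) and `S2(γ′)` (= `S″`), with `Σ =
2S″·N + (S″)²` the tree's (II.65) `sigmaCorr`. [cite: MagnenRivasseauSeneor1993, (II.66) p.344 tl.13–15, (II.65) p.344] -/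
def k66Integrand (T : Finset (Fin 4 → ℤ)) (P : GhostConfig → ℝ) (N S2 : GhostConfig → GCoeff)
    (γ' : GhostConfig) : ℝ :=
  Real.exp (-P γ') * Real.exp (-(par.ζ / 2) * sqNormBox (box4 T) (N γ')) *
    Real.exp (-(par.ζ / 2) * sigmaCorr (box4 T) (N γ') (S2 γ'))

/-- **(II.55) ⟹ (II.66) under the integral sign, EXACTLY.** If for every `γ′` the `γ′`-transformed arguments of
`∇_B` re-expand as (II.56) `((A′_s)^{−γ,2} + R)^{γ′,2} = X + S` and (II.59) `((B′_l)^{−rot γ,2} + R′)^{rot γ′,2} =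
Brot + S′` (PROVED pointwise in `…InfinitesimalGauge` §8; here hypotheses on the coefficient families, READING (Z)),
then by (II.61) (`nablaPrime_reexpand`, corrected `S″ = remS2`) and (II.64) (`sqNormBox_add`) the integrand of
(II.55) IS the integrand of (II.66) with `N = ∇(X, Brot)` and `S″`.
[cite: MagnenRivasseauSeneor1993, (II.55)–(II.66) p.343–344] -/
theorem k55Integrand_eq_k66Integrand (T : Finset (Fin 4 → ℤ)) (Sγ : Finset Momentum) (ρ₁ : ℕ) (lam : ℝ)
    (Ainv Binv : VCoeff) (P : GhostConfig → ℝ) (X S Brot S' : GhostConfig → VCoeff)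
    (h56 : ∀ γ' k μ a, gaugeTrunc2Coeff T lam Ainv (gcoeffZ Sγ γ') μ k a = (X γ' + S γ') k μ a)
    (h59 : ∀ γ' k μ a, rotTruncCoeff T lam Binv (gcoeffZ Sγ γ') μ k a = (Brot γ' + S' γ') k μ a)
    (γ' : GhostConfig) :
    k55Integrand par Nlow T Sγ ρ₁ lam Ainv Binv P γ' =
      k66Integrand par T P (fun γ' k => nablaPrime par Nlow T ρ₁ (X γ') (Brot γ') k)
        (fun γ' k => remS2 par Nlow T ρ₁ (X γ') (S γ') (Brot γ') (S' γ') k) γ' := by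
  have hB : nablaB par Nlow T ρ₁ lam Ainv Binv (gcoeffZ Sγ γ') =
      (fun k => nablaPrime par Nlow T ρ₁ (X γ') (Brot γ') k) +
        fun k => remS2 par Nlow T ρ₁ (X γ') (S γ') (Brot γ') (S' γ') k := by
    funext k
    rw [nablaB_eq_nablaPrime, Pi.add_apply, ← nablaPrime_reexpand]
    congr 1
    · funext k' μ a; exact h56 γ' k' μ a
    · funext k' μ a; exact h59 γ' k' μ a
  unfold k55Integrand k66Integrand
  rw [hB, sqNormBox_add, ← Real.exp_add, ← Real.exp_add]
  ring_nf

/-- `X(η) = A′_s + D(A′_s)η` — the shifted argument `A′_s + D(A′_s)(γ′ − γ)` of (II.56)/(II.66), `D` the tree's (II.5)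
`covDCoeff`. [cite: MagnenRivasseauSeneor1993, (II.56) p.343 tl.20, (II.66) p.344] -/
def shiftedField (T : Finset (Fin 4 → ℤ)) (lam : ℝ) (A' : VCoeff) (η : GCoeff) : VCoeff :=
  fun k μ a => A' k μ a + covDCoeff T lam A' η μ k a

/-- **`N = ∇_{RB,γ′−γ} · (A′_s + D(A′_s)(γ′ − γ))`** — the main linear form of (II.66), with the tree's (II.62)
`nablaRB` at `η = γ′ − γ`. [cite: MagnenRivasseauSeneor1993, (II.66) p.344 tl.13–15, (II.62) p.343] -/
def mainForm (T : Finset (Fin 4 → ℤ)) (ρ₁ : ℕ) (lam : ℝ) (A' B' : VCoeff) (η : GCoeff) : GCoeff :=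
  fun k => nablaRB par Nlow T ρ₁ lam B' η (shiftedField T lam A' η) k

/-- `N` IS the common shape `∇(X, Brot)` with `X = A′_s + D(A′_s)η`, `Brot = (B′_l)^{rot η,2}` — definitionally
(`nablaRB_eq_nablaPrime_rot`). [cite: MagnenRivasseauSeneor1993, (II.62) p.343, (II.66) p.344] -/
theorem mainForm_eq_nablaPrime (T : Finset (Fin 4 → ℤ)) (ρ₁ : ℕ) (lam : ℝ) (A' B' : VCoeff) (η : GCoeff)
    (k : Fin 4 → ℤ) :
    mainForm par Nlow T ρ₁ lam A' B' η k =
      nablaPrime par Nlow T ρ₁ (shiftedField T lam A' η) (fun k' μ a => rotTruncCoeff T lam B' η μ k' a) k := rfl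

/-- **(II.66), `K_{ρ₂}(A′, γ) = ∫ dν_{ρ₂}(γ′) e^{−Σ(λ^{1/2+2ε₂}γ′^i)^N} e^{−(ζ/2)(∇_{RB,γ′−γ}·(A′_s+D(A′_s)(γ′−γ)))²}
e^{−(ζ/2)Σ(A′,γ,γ′)}`** against the tree's `dν_{ρ₂}`, for primed fields `A′_s, B′_l`, the configuration `γ`, the window
`Sγ` of the ghosts, and the `γ′`-family `S″` (READINGS (Y), (Z)). [cite: MagnenRivasseauSeneor1993, (II.66) p.344 tl.13–15] -/
def Krho2Prime66 (T : Finset (Fin 4 → ℤ)) (Sγ : Finset Momentum) (ρ₁ ρ₂ : ℕ) (lam : ℝ) (A' B' : VCoeff)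
    (P : GhostConfig → ℝ) (S2 : GhostConfig → GCoeff) (γ : GhostConfig) : ℝ :=
  ∫ γ', k66Integrand par T P (fun γ' => mainForm par Nlow T ρ₁ lam A' B' (etaCoeff Sγ γ γ')) S2 γ' ∂(nu par ρ₂)

/-- **(II.55) = (II.66) as `dν_{ρ₂}(γ′)`-integrals** (every window, all `ρ₁, ρ₂, λ`, all fields): granted the pointwise
re-expansions (II.56) with `X = A′_s + D(A′_s)(γ′−γ)` and (II.59) with `Brot = (B′_l)^{rot(γ′−γ),2}` for the
coefficient families, `K_{ρ₂}(A′,γ)` of (II.55) equals the (II.66) integral with `S″ = remS2` (corrected (II.63)).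
[cite: MagnenRivasseauSeneor1993, (II.55) p.343, (II.66) p.344, (II.56)–(II.65) p.343–344] -/
theorem Krho2Prime_eq_Krho2Prime66 (T : Finset (Fin 4 → ℤ)) (Sγ : Finset Momentum) (ρ₁ ρ₂ : ℕ) (lam : ℝ)
    (Ainv Binv A' B' : VCoeff) (P : GhostConfig → ℝ) (γ : GhostConfig) (S S' : GhostConfig → VCoeff)
    (h56 : ∀ γ' k μ a, gaugeTrunc2Coeff T lam Ainv (gcoeffZ Sγ γ') μ k a =
      (shiftedField T lam A' (etaCoeff Sγ γ γ') + S γ') k μ a)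
    (h59 : ∀ γ' k μ a, rotTruncCoeff T lam Binv (gcoeffZ Sγ γ') μ k a =
      ((fun k' ν b => rotTruncCoeff T lam B' (etaCoeff Sγ γ γ') ν k' b) + S' γ') k μ a) :
    Krho2Prime par Nlow T Sγ ρ₁ ρ₂ lam Ainv Binv P =
      Krho2Prime66 par Nlow T Sγ ρ₁ ρ₂ lam A' B' P
        (fun γ' k => remS2 par Nlow T ρ₁ (shiftedField T lam A' (etaCoeff Sγ γ γ')) (S γ')
          (fun k' ν b => rotTruncCoeff T lam B' (etaCoeff Sγ γ γ') ν k' b) (S' γ') k) γ := by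
  unfold Krho2Prime Krho2Prime66
  congr 1
  funext γ'
  exact k55Integrand_eq_k66Integrand par Nlow T Sγ ρ₁ lam Ainv Binv P
    (fun γ' => shiftedField T lam A' (etaCoeff Sγ γ γ')) S
    (fun γ' k' ν b => rotTruncCoeff T lam B' (etaCoeff Sγ γ γ') ν k' b) S' h56 h59 γ'

/-! ## §2 (II.67) inside (II.66), and (II.70) p.344: `∇_{RB,γ′−γ}·(A′_s + D(A′_s)(γ′−γ)) = ∇_{RB,γ′−γ}·A′_s +
(U + V)(γ′−γ)`; `(U + V + ∇_{RB}·A′_s)² = (U + ∇_{RB}·A′_s)² + W`, `W ≡ 2V·(U + ∇_{RB}·A′_s) + V²` — EXACT -/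

/-- `∇_{RB,γ′−γ}` is ADDITIVE in the vector field it acts on (bilinearity of the printed bracket).
[cite: MagnenRivasseauSeneor1993, (II.62) p.343 tl.32–33] -/
theorem nablaRB_add_field (T : Finset (Fin 4 → ℤ)) (ρ₁ : ℕ) (lam : ℝ) (B' : VCoeff) (G : GCoeff)
    (X₁ X₂ : VCoeff) (k : Fin 4 → ℤ) :
    nablaRB par Nlow T ρ₁ lam B' G (X₁ + X₂) k =
      nablaRB par Nlow T ρ₁ lam B' G X₁ k + nablaRB par Nlow T ρ₁ lam B' G X₂ k := by
  unfold nablaRB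
  rw [← Finset.sum_add_distrib]
  refine Finset.sum_congr rfl fun μ _ => ?_
  have h1 : (fun k' => (X₁ + X₂) k' μ) = (fun k' => X₁ k' μ) + fun k' => X₂ k' μ := by
    funext k'; rfl
  have h2 : ∀ j : ℕ × ℕ, (fun r => ((par.kappaSlice Nlow j r : ℝ) : ℂ) • (X₁ + X₂) r μ) =
      (fun r => ((par.kappaSlice Nlow j r : ℝ) : ℂ) • X₁ r μ) +
        fun r => ((par.kappaSlice Nlow j r : ℝ) : ℂ) • X₂ r μ := by
    intro j; funext r; simp [smul_add]
  rw [h1, dCoeff_add]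
  simp only [h2, convCross_add_right, smul_add, Finset.sum_add_distrib]
  abel

/-- **(II.67) inside (II.66): `∇_{RB,γ′−γ}·(A′_s + D(A′_s)η) = ∇_{RB,γ′−γ}·A′_s + (U(A′_s,B′_l) + V(A′_s,B′_l,η))η`**
(`η = γ′ − γ`; the tree's (II.67) `nablaRB_covD_eq_uOp_add_vOp` plus additivity) — EXACT.
[cite: MagnenRivasseauSeneor1993, (II.66)–(II.69) p.344] -/
theorem mainForm_eq (T : Finset (Fin 4 → ℤ)) (ρ₁ : ℕ) (lam : ℝ) (A' B' : VCoeff) (η : GCoeff) (k : Fin 4 → ℤ) :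
    mainForm par Nlow T ρ₁ lam A' B' η k =
      nablaRB par Nlow T ρ₁ lam B' η A' k +
        (uOp par Nlow T ρ₁ lam A' B' η k + vOp par Nlow T ρ₁ lam A' B' η η k) := by
  have h : shiftedField T lam A' η = A' + fun k' μ => covDCoeff T lam A' η μ k' := by
    funext k' μ a; rfl
  unfold mainForm
  rw [h, nablaRB_add_field, nablaRB_covD_eq_uOp_add_vOp]

/-- **(II.70), `W ≡ 2V·(U + ∇_{RB,γ′−γ}·A′_s) + V²`** for the ghost-type families `Uη`, `Vη` and `c = ∇_{RB,γ′−γ}·A′_s`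
(«we write them like squares instead of scalar products», p.344 tl.25: `·` = the tree's `dotBox`, squares = `sqNormBox`;
so `W` is the (II.65)-shape `sigmaCorr` of the pair `(Uη + c, Vη)`). [cite: MagnenRivasseauSeneor1993, (II.70) p.344 tl.23–24] -/
def wCorr (box : Finset (Fin 4 → ℤ)) (Uη Vη c : GCoeff) : ℝ := sigmaCorr box (fun k => Uη k + c k) Vη

/-- `W` unfolded: `W = 2V·(U + ∇·A′_s) + V²`. [cite: MagnenRivasseauSeneor1993, (II.70) p.344 tl.24] -/
theorem wCorr_eq (box : Finset (Fin 4 → ℤ)) (Uη Vη c : GCoeff) :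
    wCorr box Uη Vη c = 2 * dotBox box Vη (fun k => Uη k + c k) + sqNormBox box Vη := rfl

/-- **(II.70) PROVED EXACTLY: `(U + V + ∇_{RB,γ′−γ}·A′_s)² = (U + ∇_{RB,γ′−γ}·A′_s)² + W`** on every momentum box.
[cite: MagnenRivasseauSeneor1993, (II.70) p.344 tl.23–24] -/
theorem sqNormBox_uv (box : Finset (Fin 4 → ℤ)) (Uη Vη c : GCoeff) :
    sqNormBox box (fun k => Uη k + Vη k + c k) = sqNormBox box (fun k => Uη k + c k) + wCorr box Uη Vη c := by
  have h : (fun k => Uη k + Vη k + c k) = (fun k => Uη k + c k) + Vη := by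
    funext k; simp only [Pi.add_apply]; abel
  rw [h, sqNormBox_add]
  rfl

/-- `W` vanishes with `V` (in particular at zero gauge coupling, `vOp_zero_coupling`).
[cite: MagnenRivasseauSeneor1993, (II.70) p.344, (II.69) p.344 tl.27] -/
theorem wCorr_zero (box : Finset (Fin 4 → ℤ)) (Uη c : GCoeff) : wCorr box Uη 0 c = 0 := by
  unfold wCorr; exact sigmaCorr_zero box _

/-- **The main exponent of (II.66) regrouped as the print does before (II.71):
`(∇_{RB,γ′−γ}·(A′_s + D(A′_s)(γ′−γ)))² = (U(γ′−γ) + ∇_{RB,γ′−γ}·A′_s)² + W`** — (II.67) then (II.70), EXACT.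
[cite: MagnenRivasseauSeneor1993, (II.66)–(II.70) p.344] -/
theorem sqNormBox_mainForm (T : Finset (Fin 4 → ℤ)) (ρ₁ : ℕ) (lam : ℝ) (A' B' : VCoeff) (η : GCoeff) :
    sqNormBox (box4 T) (mainForm par Nlow T ρ₁ lam A' B' η) =
      sqNormBox (box4 T) (fun k => uOp par Nlow T ρ₁ lam A' B' η k + nablaRB par Nlow T ρ₁ lam B' η A' k) +
        wCorr (box4 T) (fun k => uOp par Nlow T ρ₁ lam A' B' η k) (fun k => vOp par Nlow T ρ₁ lam A' B' η η k)
          (fun k => nablaRB par Nlow T ρ₁ lam B' η A' k) := by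
  have h : mainForm par Nlow T ρ₁ lam A' B' η = fun k => uOp par Nlow T ρ₁ lam A' B' η k +
      vOp par Nlow T ρ₁ lam A' B' η η k + nablaRB par Nlow T ρ₁ lam B' η A' k := by
    funext k; rw [mainForm_eq]; abel
  rw [h, sqNormBox_uv]


/-! ## §3 (II.71)–(II.73) p.344–345: completing the square in `γ′` — the new Gaussian variable `γ″`, the remainder
`Ω`, and the prefactor — PROVED in finite dimensions with the transpositions restored (READING (FD)) -/

namespace GhostGaussian

variable {ι κ : Type*} [Fintype ι] [DecidableEq ι] [Fintype κ]

/-- **`ζU² + Γ⁻¹`** — the inverse propagator of the new variable `γ″` («γ″ which has propagator (ζU² + Γ⁻¹)⁻¹», p.345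
tl.1; «we write U² for UᵗʳU», p.344 tl.29): `ζ UᵀU + Γ⁻¹` for a real matrix `U` (the operator (II.68) on the window
coordinates; RECTANGULAR: columns indexed by the ghost-window coordinates `ι`, rows by the value coordinates `κ` of
`Uη`, e.g. `(k, a)`) and `Γinv = Γ⁻¹` (the inverse ghost propagator of `dν_{ρ₂}`, square on `ι`).
[cite: MagnenRivasseauSeneor1993, p.344 tl.27–29, p.345 tl.1–2, (II.71) p.345] -/
def csMat (ζ : ℝ) (U : Matrix κ ι ℝ) (Γinv : Matrix ι ι ℝ) : Matrix ι ι ℝ := ζ • (Uᵀ * U) + Γinv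

/-- **`ζU(∇_{RB,γ′−γ}·A′_s) + Γ⁻¹γ`** — the numerator of (II.71)/(II.72) with the omitted transposition restored:
`ζ Uᵀc + Γ⁻¹γ`, `c = ∇_{RB,γ′−γ}·A′_s` (the window coordinates of the source term).
[cite: MagnenRivasseauSeneor1993, (II.71)–(II.72) p.345, p.344 tl.25–26] -/
def csVec (ζ : ℝ) (U : Matrix κ ι ℝ) (Γinv : Matrix ι ι ℝ) (c : κ → ℝ) (γ : ι → ℝ) : ι → ℝ := ζ • (Uᵀ *ᵥ c) + Γinv *ᵥ γ

/-- **(II.71), `γ″ = γ′ − γ + (ζU(∇_{RB,γ′−γ}·A′_s) + Γ⁻¹γ)/(ζU² + Γ⁻¹)`** — the fraction read as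
`(ζUᵀU + Γ⁻¹)⁻¹(ζUᵀc + Γ⁻¹γ)`. [cite: MagnenRivasseauSeneor1993, (II.71) p.345 tl.3–4] -/
def gammaPP (ζ : ℝ) (U : Matrix κ ι ℝ) (Γinv : Matrix ι ι ℝ) (c : κ → ℝ) (γ γ' : ι → ℝ) : ι → ℝ :=
  γ' - γ + (csMat ζ U Γinv)⁻¹ *ᵥ csVec ζ U Γinv c γ

/-- **(II.72), `Ω ≡ (ζU(∇_{RB,γ′−γ}·A′_s) + Γ⁻¹γ)²/(ζU² + Γ⁻¹) − ζ(∇_{RB,γ′−γ}·A′_s)² − γΓ⁻¹γ`** (the print has «A′_2»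
[sic] for `A′_s` in the middle term), read as `bᵀ(ζUᵀU + Γ⁻¹)⁻¹b − ζ cᵀc − γᵀΓ⁻¹γ` with `b = ζUᵀc + Γ⁻¹γ`.
[cite: MagnenRivasseauSeneor1993, (II.72) p.345 tl.6–7] -/
def Omega (ζ : ℝ) (U : Matrix κ ι ℝ) (Γinv : Matrix ι ι ℝ) (c : κ → ℝ) (γ : ι → ℝ) : ℝ :=
  csVec ζ U Γinv c γ ⬝ᵥ ((csMat ζ U Γinv)⁻¹ *ᵥ csVec ζ U Γinv c γ) - ζ * (c ⬝ᵥ c) - γ ⬝ᵥ (Γinv *ᵥ γ)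

/-- **Twice the total quadratic exponent in `γ′`** before completing the square: the Gaussian weight of `dν_{ρ₂}(γ′) ∝
e^{−½γ′ᵀΓ⁻¹γ′}dγ′` joined with the main piece `e^{−(ζ/2)(U(γ′−γ) + ∇_{RB,γ′−γ}·A′_s)²}` of (II.66)/(II.70):
`E(γ′) = γ′ᵀΓ⁻¹γ′ + ζ‖U(γ′ − γ) + c‖²`. [cite: MagnenRivasseauSeneor1993, p.344 tl.27–35, (II.70)–(II.71) p.344–345] -/
def csExponent (ζ : ℝ) (U : Matrix κ ι ℝ) (Γinv : Matrix ι ι ℝ) (c : κ → ℝ) (γ γ' : ι → ℝ) : ℝ :=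
  γ' ⬝ᵥ (Γinv *ᵥ γ') + ζ * ((U *ᵥ (γ' - γ) + c) ⬝ᵥ (U *ᵥ (γ' - γ) + c))

omit [DecidableEq ι] in
/-- Moving a real matrix across the dot product: `(A x)·y = x·(Aᵀ y)` (the «transpositions … which are
straightforward», p.344 tl.26). [cite: MagnenRivasseauSeneor1993, p.344 tl.25–26] -/
theorem mulVec_dotProduct_eq_dotProduct_transpose_mulVec (A : Matrix κ ι ℝ) (x : ι → ℝ) (y : κ → ℝ) :
    (A *ᵥ x) ⬝ᵥ y = x ⬝ᵥ (Aᵀ *ᵥ y) := by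
  rw [dotProduct_comm, Matrix.dotProduct_mulVec, dotProduct_comm, Matrix.mulVec_transpose]

omit [DecidableEq ι] in
/-- For a symmetric real matrix the bilinear form is symmetric (private helper). [folklore] -/
private theorem dotProduct_mulVec_comm_of_isSymm {S : Matrix ι ι ℝ} (hS : S.IsSymm) (x y : ι → ℝ) :
    x ⬝ᵥ (S *ᵥ y) = y ⬝ᵥ (S *ᵥ x) := by
  rw [dotProduct_comm y, mulVec_dotProduct_eq_dotProduct_transpose_mulVec, hS.eq]

omit [Fintype ι] [DecidableEq ι] in
/-- `ζU² + Γ⁻¹` is symmetric when `Γ⁻¹` is. [cite: MagnenRivasseauSeneor1993, p.345 tl.1] -/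
theorem isSymm_csMat (ζ : ℝ) (U : Matrix κ ι ℝ) {Γinv : Matrix ι ι ℝ} (hΓ : Γinv.IsSymm) :
    (csMat ζ U Γinv).IsSymm := by
  unfold csMat Matrix.IsSymm
  rw [Matrix.transpose_add, Matrix.transpose_smul, Matrix.transpose_mul, Matrix.transpose_transpose, hΓ.eq]

omit [DecidableEq ι] in
/-- The bilinear form of `ζU² + Γ⁻¹`: `vᵀ(ζUᵀU + Γ⁻¹)w = ζ (Uv)·(Uw) + vᵀΓ⁻¹w`.
[cite: MagnenRivasseauSeneor1993, p.344 tl.29 «(ζ/2)⟨γ′ − γ, UᵗʳU(γ′ − γ)⟩»] -/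
theorem dotProduct_csMat_mulVec (ζ : ℝ) (U : Matrix κ ι ℝ) (Γinv : Matrix ι ι ℝ) (v w : ι → ℝ) :
    v ⬝ᵥ (csMat ζ U Γinv *ᵥ w) = ζ * ((U *ᵥ v) ⬝ᵥ (U *ᵥ w)) + v ⬝ᵥ (Γinv *ᵥ w) := by
  unfold csMat
  rw [Matrix.add_mulVec, Matrix.smul_mulVec, ← Matrix.mulVec_mulVec, dotProduct_add, dotProduct_smul,
    mulVec_dotProduct_eq_dotProduct_transpose_mulVec, smul_eq_mul]

omit [DecidableEq ι] in
/-- The linear term: `vᵀ(ζUᵀc + Γ⁻¹γ) = ζ (Uv)·c + vᵀΓ⁻¹γ`. [cite: MagnenRivasseauSeneor1993, (II.71) p.345] -/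
theorem dotProduct_csVec (ζ : ℝ) (U : Matrix κ ι ℝ) (Γinv : Matrix ι ι ℝ) (c : κ → ℝ) (γ v : ι → ℝ) :
    v ⬝ᵥ csVec ζ U Γinv c γ = ζ * ((U *ᵥ v) ⬝ᵥ c) + v ⬝ᵥ (Γinv *ᵥ γ) := by
  unfold csVec
  rw [dotProduct_add, dotProduct_smul, mulVec_dotProduct_eq_dotProduct_transpose_mulVec, smul_eq_mul]

/-- **COMPLETING THE SQUARE (II.71)/(II.72), PROVED**: for symmetric `Γ⁻¹` and invertible `ζU² + Γ⁻¹`,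
`γ′ᵀΓ⁻¹γ′ + ζ‖U(γ′−γ) + c‖² = γ″ᵀ(ζU² + Γ⁻¹)γ″ − Ω` with `γ″` of (II.71) and `Ω` of (II.72) — i.e.
`e^{−½γ′ᵀΓ⁻¹γ′} e^{−(ζ/2)(U(γ′−γ)+c)²} = e^{Ω/2} e^{−½γ″ᵀ(ζU²+Γ⁻¹)γ″}` («by completing the square», p.345 tl.10).
[cite: MagnenRivasseauSeneor1993, (II.71)–(II.73) p.345 tl.1–10] -/
theorem csExponent_eq (ζ : ℝ) (U : Matrix κ ι ℝ) {Γinv : Matrix ι ι ℝ} (hΓ : Γinv.IsSymm)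
    (hM : IsUnit (csMat ζ U Γinv).det) (c : κ → ℝ) (γ γ' : ι → ℝ) :
    csExponent ζ U Γinv c γ γ' =
      gammaPP ζ U Γinv c γ γ' ⬝ᵥ (csMat ζ U Γinv *ᵥ gammaPP ζ U Γinv c γ γ') - Omega ζ U Γinv c γ := by
  -- notation
  set M := csMat ζ U Γinv with hMdef
  set b := csVec ζ U Γinv c γ with hbdef
  set y := γ' - γ with hy
  set d := M⁻¹ *ᵥ b with hd
  have hγ' : γ' = y + γ := by rw [hy, sub_add_cancel]
  have hMd : M *ᵥ d = b := by
    rw [hd, Matrix.mulVec_mulVec, Matrix.mul_nonsing_inv _ hM, Matrix.one_mulVec]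
  have symM : ∀ v w : ι → ℝ, v ⬝ᵥ (M *ᵥ w) = w ⬝ᵥ (M *ᵥ v) :=
    dotProduct_mulVec_comm_of_isSymm (isSymm_csMat ζ U hΓ)
  have symΓ : ∀ v w : ι → ℝ, v ⬝ᵥ (Γinv *ᵥ w) = w ⬝ᵥ (Γinv *ᵥ v) := dotProduct_mulVec_comm_of_isSymm hΓ
  -- the right-hand side: γ″ᵀMγ″ = yᵀMy + 2 yᵀb + bᵀd
  have hpp : gammaPP ζ U Γinv c γ γ' = y + d := rfl
  have hR : (y + d) ⬝ᵥ (M *ᵥ (y + d)) = y ⬝ᵥ (M *ᵥ y) + 2 * (y ⬝ᵥ b) + b ⬝ᵥ d := by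
    rw [Matrix.mulVec_add, dotProduct_add, add_dotProduct, add_dotProduct, hMd, symM d y, hMd, dotProduct_comm d b]
    ring
  have hΩ : Omega ζ U Γinv c γ = b ⬝ᵥ d - ζ * (c ⬝ᵥ c) - γ ⬝ᵥ (Γinv *ᵥ γ) := rfl
  -- expansions of the atoms
  have e1 : y ⬝ᵥ (M *ᵥ y) = ζ * ((U *ᵥ y) ⬝ᵥ (U *ᵥ y)) + y ⬝ᵥ (Γinv *ᵥ y) := dotProduct_csMat_mulVec ζ U Γinv y y
  have e2 : y ⬝ᵥ b = ζ * ((U *ᵥ y) ⬝ᵥ c) + y ⬝ᵥ (Γinv *ᵥ γ) := dotProduct_csVec ζ U Γinv c γ y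
  -- the left-hand side
  have hL1 : γ' ⬝ᵥ (Γinv *ᵥ γ') = y ⬝ᵥ (Γinv *ᵥ y) + 2 * (y ⬝ᵥ (Γinv *ᵥ γ)) + γ ⬝ᵥ (Γinv *ᵥ γ) := by
    rw [hγ', Matrix.mulVec_add, dotProduct_add, add_dotProduct, add_dotProduct, symΓ γ y]
    ring
  have hL2 : (U *ᵥ (γ' - γ) + c) ⬝ᵥ (U *ᵥ (γ' - γ) + c) =
      (U *ᵥ y) ⬝ᵥ (U *ᵥ y) + 2 * ((U *ᵥ y) ⬝ᵥ c) + c ⬝ᵥ c := by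
    rw [← hy, dotProduct_add, add_dotProduct, add_dotProduct, dotProduct_comm c (U *ᵥ y)]
    ring
  unfold csExponent
  rw [hpp, hR, hΩ, hL1, hL2, e1, e2]
  ring

omit [DecidableEq ι] in
/-- `ζU² + Γ⁻¹` is POSITIVE DEFINITE — hence invertible — for `ζ ≥ 0` and positive-definite `Γ⁻¹` (the printed regime:
`ζ` «close to 3/13», `Γ_{ρ₂}` a genuine covariance). [cite: MagnenRivasseauSeneor1993, p.345 tl.1, (II.36) p.339, p.332 tl.40] -/
theorem posDef_csMat {ζ : ℝ} (hζ : 0 ≤ ζ) (U : Matrix κ ι ℝ) {Γinv : Matrix ι ι ℝ} (hΓ : Γinv.PosDef) :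
    (csMat ζ U Γinv).PosDef := by
  unfold csMat
  have h1 : (Uᵀ * U).PosSemidef := by
    simpa only [Matrix.conjTranspose_eq_transpose_of_trivial] using Matrix.posSemidef_conjTranspose_mul_self U
  exact Matrix.PosDef.posSemidef_add (h1.smul hζ) hΓ

/-- … so its determinant is a unit. [cite: MagnenRivasseauSeneor1993, p.345 tl.1] -/
theorem isUnit_det_csMat {ζ : ℝ} (hζ : 0 ≤ ζ) (U : Matrix κ ι ℝ) {Γinv : Matrix ι ι ℝ} (hΓ : Γinv.PosDef) :
    IsUnit (csMat ζ U Γinv).det :=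
  ((posDef_csMat hζ U hΓ).isUnit).map Matrix.detMonoidHom

omit [Fintype ι] [DecidableEq ι] in
/-- A positive-definite real matrix is symmetric (private helper). [folklore] -/
private theorem isSymm_of_posDef {Γinv : Matrix ι ι ℝ} (hΓ : Γinv.PosDef) : Γinv.IsSymm := by
  have h := hΓ.isHermitian
  rw [Matrix.IsHermitian, Matrix.conjTranspose_eq_transpose_of_trivial] at h
  exact h

omit [DecidableEq ι] in
/-- The quadratic exponent is NONNEGATIVE (`Γ⁻¹ ⪰ 0`, `ζ ≥ 0`). [cite: MagnenRivasseauSeneor1993, p.344 tl.27–29] -/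
theorem csExponent_nonneg {ζ : ℝ} (hζ : 0 ≤ ζ) (U : Matrix κ ι ℝ) {Γinv : Matrix ι ι ℝ} (hΓ : Γinv.PosSemidef)
    (c : κ → ℝ) (γ γ' : ι → ℝ) : 0 ≤ csExponent ζ U Γinv c γ γ' := by
  unfold csExponent
  have h1 : 0 ≤ γ' ⬝ᵥ (Γinv *ᵥ γ') := by
    simpa only [star_trivial] using hΓ.dotProduct_mulVec_nonneg γ'
  have h2 : 0 ≤ (U *ᵥ (γ' - γ) + c) ⬝ᵥ (U *ᵥ (γ' - γ) + c) := by
    simpa only [star_trivial] using dotProduct_star_self_nonneg (U *ᵥ (γ' - γ) + c)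
  exact add_nonneg h1 (mul_nonneg hζ h2)

/-- **`Ω ≤ 0`** — the completed square cannot exceed the nonnegative form: evaluating the identity at the minimiser
`γ′ = γ − (ζU²+Γ⁻¹)⁻¹(ζUᵀc + Γ⁻¹γ)` (where `γ″ = 0`) gives `−Ω = E ≥ 0`. So the factor `e^{Ω/2}` produced by
completing the square is `≤ 1` («Ω is small», p.345 tl.8). [cite: MagnenRivasseauSeneor1993, (II.72) p.345 tl.6–10] -/
theorem Omega_nonpos {ζ : ℝ} (hζ : 0 ≤ ζ) (U : Matrix κ ι ℝ) {Γinv : Matrix ι ι ℝ} (hΓ : Γinv.PosDef)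
    (c : κ → ℝ) (γ : ι → ℝ) : Omega ζ U Γinv c γ ≤ 0 := by
  have hM := isUnit_det_csMat hζ U hΓ
  set γ₀ := γ - (csMat ζ U Γinv)⁻¹ *ᵥ csVec ζ U Γinv c γ with hγ₀
  have h0 : gammaPP ζ U Γinv c γ γ₀ = 0 := by
    rw [gammaPP, hγ₀]; abel
  have h := csExponent_eq ζ U (isSymm_of_posDef hΓ) hM c γ γ₀
  rw [h0, zero_dotProduct, zero_sub] at h
  have := csExponent_nonneg hζ U hΓ.posSemidef c γ γ₀
  linarith


/-- **«Ω is small as Γ⁻¹ when Γ⁻¹ → 0»** (p.345 tl.8): at `Γ⁻¹ = 0`, for invertible `U` and `ζ ≠ 0`, `Ω = 0` EXACTLY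
(then `(ζU²)⁻¹(ζUᵀc) = U⁻¹c` and `(ζUᵀc)·(U⁻¹c) = ζ c·c`). [cite: MagnenRivasseauSeneor1993, p.345 tl.8–10, (II.72) p.345] -/
theorem Omega_eq_zero_of_noPropagator {ζ : ℝ} (hζ : ζ ≠ 0) {U : Matrix ι ι ℝ} (hU : IsUnit U.det) (c γ : ι → ℝ) :
    Omega ζ U 0 c γ = 0 := by
  have hb : csVec ζ U 0 c γ = ζ • (Uᵀ *ᵥ c) := by simp [csVec]
  have hMdet : IsUnit (csMat ζ U 0).det := by
    unfold csMat
    rw [add_zero, Matrix.det_smul, Matrix.det_mul, Matrix.det_transpose]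
    exact ((IsUnit.mk0 ζ hζ).pow _).mul (hU.mul hU)
  have hMd : csMat ζ U 0 *ᵥ (U⁻¹ *ᵥ c) = csVec ζ U 0 c γ := by
    rw [hb, csMat, add_zero, Matrix.smul_mulVec, ← Matrix.mulVec_mulVec, Matrix.mulVec_mulVec c U,
      Matrix.mul_nonsing_inv _ hU, Matrix.one_mulVec]
  have hd : (csMat ζ U 0)⁻¹ *ᵥ csVec ζ U 0 c γ = U⁻¹ *ᵥ c := by
    rw [← hMd, Matrix.mulVec_mulVec, Matrix.nonsing_inv_mul _ hMdet, Matrix.one_mulVec]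
  unfold Omega
  rw [hd, hb, smul_dotProduct, mulVec_dotProduct_eq_dotProduct_transpose_mulVec, Matrix.transpose_transpose,
    Matrix.mulVec_mulVec, Matrix.mul_nonsing_inv _ hU, Matrix.one_mulVec, Matrix.zero_mulVec, dotProduct_zero,
    smul_eq_mul]
  ring

/-- **(II.73) «by completing the square» — the re-integration identity, PROVED (Lebesgue form, finite dimensions).**
For symmetric `Γ⁻¹` with `ζU² + Γ⁻¹` invertible and ANY weight `F` (in print `F = e^{−damping(γ′)} e^{−(ζ/2)(Σ+W)}`):
`∫ dγ′ e^{−½γ′ᵀΓ⁻¹γ′} e^{−(ζ/2)(U(γ′−γ)+∇·A′_s)²} F(γ′) = e^{Ω/2} ∫ dγ″ e^{−½γ″ᵀ(ζU²+Γ⁻¹)γ″} F(γ′(γ″, γ))` with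
`γ′(γ″, γ) = γ″ + γ − (ζU²+Γ⁻¹)⁻¹(ζUᵀc + Γ⁻¹γ)` the inverse of (II.71) (translation invariance of Lebesgue measure on
the window coordinates). NOTE (as-printed precision, not adjudicated): completing the square produces the factor
`e^{+Ω/2}` with the `Ω ≤ 0` of (II.72) (`Omega_nonpos`); (II.73)/(II.76) print it inside `e^{−(ζ/2)(Σ+W+Ω)}`.
[cite: MagnenRivasseauSeneor1993, (II.71)–(II.73) p.345 tl.1–10] -/
theorem integral_completing_square (ζ : ℝ) (U : Matrix κ ι ℝ) {Γinv : Matrix ι ι ℝ} (hΓ : Γinv.IsSymm)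
    (hM : IsUnit (csMat ζ U Γinv).det) (c : κ → ℝ) (γ : ι → ℝ) (F : (ι → ℝ) → ℝ) :
    ∫ γ', Real.exp (-(1 / 2 : ℝ) * csExponent ζ U Γinv c γ γ') * F γ' =
      Real.exp (Omega ζ U Γinv c γ / 2) *
        ∫ y, Real.exp (-(1 / 2 : ℝ) * (y ⬝ᵥ (csMat ζ U Γinv *ᵥ y))) *
          F (y + (γ - (csMat ζ U Γinv)⁻¹ *ᵥ csVec ζ U Γinv c γ)) := by
  set s := γ - (csMat ζ U Γinv)⁻¹ *ᵥ csVec ζ U Γinv c γ with hs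
  have hpp : ∀ γ', gammaPP ζ U Γinv c γ γ' = γ' - s := by
    intro γ'; rw [gammaPP, hs]; abel
  have h1 : ∀ γ', Real.exp (-(1 / 2 : ℝ) * csExponent ζ U Γinv c γ γ') * F γ' =
      Real.exp (Omega ζ U Γinv c γ / 2) *
        (Real.exp (-(1 / 2 : ℝ) * ((γ' - s) ⬝ᵥ (csMat ζ U Γinv *ᵥ (γ' - s)))) * F (γ' - s + s)) := by
    intro γ'
    rw [csExponent_eq ζ U hΓ hM, hpp, sub_add_cancel, ← mul_assoc, ← Real.exp_add]
    congr 2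
    ring
  simp_rw [h1]
  rw [integral_const_mul]
  congr 1
  exact integral_sub_right_eq_self
    (fun y => Real.exp (-(1 / 2 : ℝ) * (y ⬝ᵥ (csMat ζ U Γinv *ᵥ y))) * F (y + s)) s

/-- The Gaussian normalisation `Z(Q) = ∫ dy e^{−½yᵀQy}` over the window coordinates (a real number; for positive-definite
`Q` it is `(2π)^{n/2}(det Q)^{−1/2}`, `gaussZ_eq` §6). [cite: MagnenRivasseauSeneor1993, p.345 tl.11–13] -/
def gaussZ (Q : Matrix ι ι ℝ) : ℝ := ∫ y : ι → ℝ, Real.exp (-(1 / 2 : ℝ) * (y ⬝ᵥ (Q *ᵥ y)))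

/-- **The normalised Gaussian expectation `∫ dπ_Q(y) G(y)`** with `dπ_Q(y) = Z(Q)⁻¹e^{−½yᵀQy}dy` — for `Q = Γ⁻¹` this is
`∫ dν_{ρ₂}(γ′) G(γ′)` on the window coordinates (READING (FD)), for `Q = ζU² + Γ⁻¹` it is the print's `∫ dπ_{ρ₂}(γ″) G(γ″)`
(«γ″ which has propagator (ζU² + Γ⁻¹)⁻¹», p.345 tl.1). [cite: MagnenRivasseauSeneor1993, (II.73) p.345, (II.36) p.339] -/
def gaussExpect (Q : Matrix ι ι ℝ) (G : (ι → ℝ) → ℝ) : ℝ :=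
  (gaussZ Q)⁻¹ * ∫ y : ι → ℝ, Real.exp (-(1 / 2 : ℝ) * (y ⬝ᵥ (Q *ᵥ y))) * G y

/-- **(II.73) in the print's normalised form**, PROVED modulo the value of the normalisations: with `M = ζU² + Γ⁻¹`,
`∫ dν_Γ(γ′) e^{−(ζ/2)(U(γ′−γ)+c)²} F(γ′) = (Z(M)/Z(Γ⁻¹)) · e^{Ω/2} · ∫ dπ_M(γ″) F(γ′(γ″,γ))`; the print's prefactor
`(det (ζU²+Γ⁻¹)/Γ⁻¹)^{−1/2}` is the value of `Z(M)/Z(Γ⁻¹)` (`gaussZ_ratio`, §6).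
[cite: MagnenRivasseauSeneor1993, (II.73) p.345 tl.9–13] -/
theorem gaussExpect_completing_square (ζ : ℝ) (U : Matrix κ ι ℝ) {Γinv : Matrix ι ι ℝ} (hΓ : Γinv.IsSymm)
    (hM : IsUnit (csMat ζ U Γinv).det) (hZ : gaussZ (csMat ζ U Γinv) ≠ 0) (c : κ → ℝ) (γ : ι → ℝ) (F : (ι → ℝ) → ℝ) :
    gaussExpect Γinv (fun γ' => Real.exp (-(ζ / 2) * ((U *ᵥ (γ' - γ) + c) ⬝ᵥ (U *ᵥ (γ' - γ) + c))) * F γ') =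
      (gaussZ (csMat ζ U Γinv) / gaussZ Γinv) * Real.exp (Omega ζ U Γinv c γ / 2) *
        gaussExpect (csMat ζ U Γinv) (fun y => F (y + (γ - (csMat ζ U Γinv)⁻¹ *ᵥ csVec ζ U Γinv c γ))) := by
  unfold gaussExpect
  have h1 : ∀ γ', Real.exp (-(1 / 2 : ℝ) * (γ' ⬝ᵥ (Γinv *ᵥ γ'))) *
      (Real.exp (-(ζ / 2) * ((U *ᵥ (γ' - γ) + c) ⬝ᵥ (U *ᵥ (γ' - γ) + c))) * F γ') =
      Real.exp (-(1 / 2 : ℝ) * csExponent ζ U Γinv c γ γ') * F γ' := by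
    intro γ'
    rw [← mul_assoc, ← Real.exp_add, csExponent]
    congr 2
    ring
  simp_rw [h1]
  rw [integral_completing_square ζ U hΓ hM c γ F]
  field_simp

end GhostGaussian

/-! ## §4 (II.74), (II.75), (II.77) p.345–346: the operator algebra of `ζUᵗʳU + Γ⁻¹`, its version with the true cutoff
`κ_ρ(p)` on the vertex, and the reduction to `det|Δ − λκ_ρ(p)(∂[A′_s,·] + Σ_j[κ_j∗B′_l, κ^j∗∂·])|` -/

namespace FPOperator

variable {R : Type*} [Ring R] [Algebra ℝ R]

/-- **(II.74) PROVED as an identity in any real operator algebra** (so for the window matrices): with `U = Δ − λX`,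
`X = ∂[A′_s,·] + Σ_j[κ_j∗B′_l, κ^j∗∂·]` ((II.68): `U = ∂² − λ∂[A′_s,·] − λΣ_j[…]`, `Δ` «the ordinary Laplacian»), `Γinv =
Γ⁻¹`, and `P = ζΔ² + Γ⁻¹` invertible (a unit `u`),
`ζU² + Γ⁻¹ = (ζΔ²+Γ⁻¹)(1 − λ (ζΔ/(ζΔ²+Γ⁻¹)) X − λ (1/(ζΔ²+Γ⁻¹)) X ζΔ + λ² (ζ/(ζΔ²+Γ⁻¹)) X²)` — reading every
fraction `Y/(ζΔ²+Γ⁻¹)` as `P⁻¹Y` placed where the print places it, and «U² for UᵗʳU» (p.344 tl.29) literally as the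
square `(Δ − λX)(Δ − λX)`; no commutation of `Δ` with `X` is used. [cite: MagnenRivasseauSeneor1993, (II.74) p.345 tl.21–28, (II.68) p.344] -/
theorem opExpand (ζ lam : ℝ) (Δ X Γinv : R) (u : Rˣ) (hu : (u : R) = ζ • (Δ * Δ) + Γinv) :
    ζ • ((Δ - lam • X) * (Δ - lam • X)) + Γinv =
      (u : R) * (1 - lam • ((↑u⁻¹ : R) * (ζ • Δ) * X) - lam • ((↑u⁻¹ : R) * X * (ζ • Δ)) +
        (lam ^ 2) • ((↑u⁻¹ : R) * (ζ • (X * X)))) := by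
  have e1 : (u : R) * ((↑u⁻¹ : R) * (ζ • Δ) * X) = (ζ • Δ) * X := by
    rw [mul_assoc (↑u⁻¹ : R) (ζ • Δ) X, Units.mul_inv_cancel_left]
  have e2 : (u : R) * ((↑u⁻¹ : R) * X * (ζ • Δ)) = X * (ζ • Δ) := by
    rw [mul_assoc (↑u⁻¹ : R) X (ζ • Δ), Units.mul_inv_cancel_left]
  have e3 : (u : R) * ((↑u⁻¹ : R) * (ζ • (X * X))) = ζ • (X * X) := Units.mul_inv_cancel_left u _
  have hR : (u : R) * (1 - lam • ((↑u⁻¹ : R) * (ζ • Δ) * X) - lam • ((↑u⁻¹ : R) * X * (ζ • Δ)) +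
      (lam ^ 2) • ((↑u⁻¹ : R) * (ζ • (X * X)))) =
      ζ • (Δ * Δ) + Γinv - lam • ((ζ • Δ) * X) - lam • (X * (ζ • Δ)) + (lam ^ 2) • (ζ • (X * X)) := by
    rw [mul_add, mul_sub, mul_sub, mul_one, mul_smul_comm lam (u : R), mul_smul_comm lam (u : R),
      mul_smul_comm (lam ^ 2) (u : R), e1, e2, e3, hu]
  rw [hR]
  simp only [mul_sub, sub_mul, smul_mul_assoc, mul_smul_comm, smul_sub, smul_smul, pow_two]
  module

/-- **(II.75), `(ζUᵗʳU + Γ⁻¹)_ρ`** — «we change this operator into» the same expression with the TRUE cutoff `κ_ρ(p)` put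
on each vertex: `(ζΔ²+Γ⁻¹)(1 − λκ_ρ (ζΔ/(ζΔ²+Γ⁻¹)) X − λ κ_ρ (1/(ζΔ²+Γ⁻¹)) X ζΔ + λ² (ζκ_ρ²/(ζΔ²+Γ⁻¹)) X²)`, `κ`
standing leftmost in each term as printed. AS-PRINTED PRECISION (declared): the display's leading factor reads
«(ζΔ + Γ⁻¹)»; typed `ζΔ² + Γ⁻¹` as in (II.74) one display earlier (with «ζΔ + Γ⁻¹» the `λ = 0` value would not be
`ζU² + Γ⁻¹ = ζΔ² + Γ⁻¹`, see `opRho_zero_coupling`). [cite: MagnenRivasseauSeneor1993, (II.75) p.346 tl.2–9] -/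
def opRho (ζ lam : ℝ) (κ Δ X : R) (u : Rˣ) : R :=
  (u : R) * (1 - lam • (κ * ((↑u⁻¹ : R) * (ζ • Δ) * X)) - lam • (κ * ((↑u⁻¹ : R) * X * (ζ • Δ))) +
    (lam ^ 2) • (ζ • (κ * κ * ((↑u⁻¹ : R) * (X * X)))))

/-- At `κ_ρ ≡ 1` (no true cutoff) (II.75) IS (II.74): `(ζUᵗʳU + Γ⁻¹)_ρ = ζU² + Γ⁻¹`.
[cite: MagnenRivasseauSeneor1993, (II.74)–(II.75) p.345–346] -/
theorem opRho_one (ζ lam : ℝ) (Δ X Γinv : R) (u : Rˣ) (hu : (u : R) = ζ • (Δ * Δ) + Γinv) :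
    opRho ζ lam 1 Δ X u = ζ • ((Δ - lam • X) * (Δ - lam • X)) + Γinv := by
  rw [opExpand ζ lam Δ X Γinv u hu, opRho]
  simp only [one_mul, mul_smul_comm, smul_smul]

/-- At zero coupling (II.75) is the free operator `ζΔ² + Γ⁻¹` (the unit `u`), whatever `κ_ρ`.
[cite: MagnenRivasseauSeneor1993, (II.75) p.346] -/
theorem opRho_zero_coupling (ζ : ℝ) (κ Δ X : R) (u : Rˣ) : opRho ζ 0 κ Δ X u = u := by
  simp [opRho]

end FPOperator

namespace FPOperator

variable {K : Type*} [Field K]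

/-- **(II.75) in the commuting-symbol reading** (all of `κ_ρ(p)`, `Δ`, `X` read as commuting multipliers — the print's
regime «at zero external momenta for A′», p.346 tl.13–14, where the vertex is diagonal in momentum): `(ζUᵗʳU+Γ⁻¹)_ρ =
ζ(Δ − λκ_ρX)² + Γ⁻¹`, i.e. (II.74) with `λ ↦ λκ_ρ(p)`. [cite: MagnenRivasseauSeneor1993, (II.75) p.346, p.346 tl.13–14] -/
theorem opRho_comm (ζ lam κ Δ X Γinv : K) (hP : ζ * Δ ^ 2 + Γinv ≠ 0) :
    (ζ * Δ ^ 2 + Γinv) * (1 - lam * κ * (ζ * Δ / (ζ * Δ ^ 2 + Γinv)) * X -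
        lam * (κ / (ζ * Δ ^ 2 + Γinv)) * X * (ζ * Δ) + lam ^ 2 * (ζ * κ ^ 2 / (ζ * Δ ^ 2 + Γinv)) * X ^ 2) =
      ζ * (Δ - lam * κ * X) ^ 2 + Γinv := by
  field_simp
  ring

/-- **(II.77) in the commuting-symbol reading, PROVED** — «taking out constant factors … at this order we obtain therefore
as only contribution» `(det Δ²(1 − λκ_ρΔ⁻¹X − λκ_ρΔ⁻²XΔ + λ²κ_ρ²Δ⁻²X²))^{1/2} = det|Δ − λκ_ρX|`: for commuting symbols
the operator inside IS the square `(Δ − λκ_ρX)²` (so for simultaneously diagonal window matrices the determinant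
identity follows entrywise, `Real.sqrt_sq_eq_abs`). AS-PRINTED PRECISION (declared): the display's last term carries
«+ λ κ_ρ²(p)/Δ²»; typed `λ²` as in (II.75). [cite: MagnenRivasseauSeneor1993, (II.77) p.346 tl.17–22] -/
theorem fpSquare_comm (lam κ Δ X : K) (hΔ : Δ ≠ 0) :
    Δ ^ 2 * (1 - lam * κ * Δ⁻¹ * X - lam * κ * (Δ ^ 2)⁻¹ * X * Δ + lam ^ 2 * (κ ^ 2 / Δ ^ 2) * X ^ 2) =
      (Δ - lam * κ * X) ^ 2 := by
  field_simp
  ring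

/-- … and `√(y²) = |y|`: the square root of the determinant of a square is the absolute determinant, entry by entry in
the commuting reading («= det|Δ − λκ_ρ(p)(…)|», (II.77)). [cite: MagnenRivasseauSeneor1993, (II.77) p.346 tl.22] -/
theorem sqrt_sq_eq_abs_det (lam κ Δ X : ℝ) (hΔ : Δ ≠ 0) :
    Real.sqrt (Δ ^ 2 * (1 - lam * κ * Δ⁻¹ * X - lam * κ * (Δ ^ 2)⁻¹ * X * Δ + lam ^ 2 * (κ ^ 2 / Δ ^ 2) * X ^ 2)) =
      |Δ - lam * κ * X| := by
  rw [fpSquare_comm lam κ Δ X hΔ, Real.sqrt_sq_eq_abs]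

end FPOperator

namespace GhostGaussian

variable {ι : Type*} [Fintype ι] [DecidableEq ι]

/-- **(II.77) for window matrices**: if the cut-off vertex `κX` commutes with `Δ` and `κ` commutes with `X` (the print's
«zero external momenta for A′» regime, where all three are momentum multipliers), then
`Δ²(1 − λκΔ⁻¹X − λκΔ⁻²XΔ + λ²κ²Δ⁻²X²) = (Δ − λκX)²` as matrices and hence
`(det …)^{1/2} = |det(Δ − λκX)|` — «the same as the ordinary Fadeev-Popov determinant with a cutoff on the ghosts
propagator … and a ghost-ghost-field vertex», p.346 tl.23–25. [cite: MagnenRivasseauSeneor1993, (II.77) p.346 tl.17–25] -/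
theorem sqrt_det_fpSquare (lam : ℝ) (κ Δ X : Matrix ι ι ℝ) (hΔ : IsUnit Δ.det) (hκΔ : Commute κ Δ)
    (hκX : Commute κ X) (hXΔ : Commute X Δ) :
    Real.sqrt (Matrix.det (Δ ^ 2 * (1 - lam • (κ * Δ⁻¹ * X) - lam • (κ * (Δ ^ 2)⁻¹ * X * Δ) +
        (lam ^ 2) • (κ ^ 2 * (Δ ^ 2)⁻¹ * X ^ 2)))) = |Matrix.det (Δ - lam • (κ * X))| := by
  have hΔ2 : IsUnit (Δ ^ 2).det := by rw [Matrix.det_pow]; exact hΔ.pow 2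
  have h1 : Δ ^ 2 * (κ * Δ⁻¹ * X) = κ * Δ * X := by
    rw [pow_two, ← mul_assoc, ← mul_assoc, mul_assoc Δ Δ κ, ← hκΔ.eq, ← mul_assoc, mul_assoc (Δ * κ) Δ Δ⁻¹,
      Matrix.mul_nonsing_inv _ hΔ, mul_one, hκΔ.eq]
  have h2 : Δ ^ 2 * (κ * (Δ ^ 2)⁻¹ * X * Δ) = κ * X * Δ := by
    have hc : Commute κ (Δ ^ 2) := hκΔ.pow_right 2
    rw [← mul_assoc, ← mul_assoc, ← mul_assoc, ← hc.eq, mul_assoc κ, Matrix.mul_nonsing_inv _ hΔ2, mul_one]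
  have h3 : Δ ^ 2 * (κ ^ 2 * (Δ ^ 2)⁻¹ * X ^ 2) = κ ^ 2 * X ^ 2 := by
    have hc : Commute (κ ^ 2) (Δ ^ 2) := (hκΔ.pow_right 2).pow_left 2
    rw [← mul_assoc, ← mul_assoc, ← hc.eq, mul_assoc (κ ^ 2), Matrix.mul_nonsing_inv _ hΔ2, mul_one]
  have hsq : Δ ^ 2 * (1 - lam • (κ * Δ⁻¹ * X) - lam • (κ * (Δ ^ 2)⁻¹ * X * Δ) +
      (lam ^ 2) • (κ ^ 2 * (Δ ^ 2)⁻¹ * X ^ 2)) = (Δ - lam • (κ * X)) ^ 2 := by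
    rw [mul_add, mul_sub, mul_sub, mul_one, mul_smul_comm, mul_smul_comm, mul_smul_comm, h1, h2, h3]
    rw [pow_two (Δ - lam • (κ * X)), sub_mul, mul_sub, mul_sub, smul_mul_assoc, mul_smul_comm, smul_mul_assoc,
      mul_smul_comm, smul_smul, ← mul_assoc Δ κ X, ← hκΔ.eq]
    have h4 : κ * X * (κ * X) = κ ^ 2 * X ^ 2 := by
      rw [pow_two, pow_two, mul_assoc, ← mul_assoc X κ X, ← hκX.eq, mul_assoc, mul_assoc]
    rw [h4, ← pow_two, pow_two Δ]
    have h5 : κ * X * Δ = κ * Δ * X := by rw [mul_assoc, hXΔ.eq, ← mul_assoc]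
    rw [h5]
    module
  rw [hsq, Matrix.det_pow, Real.sqrt_sq_eq_abs]

end GhostGaussian

/-! ## §5 (II.76) p.346: `K_{ρ,ρ₂}(A′, γ)` — the definition, in the finite-dimensional reading -/

namespace GhostGaussian

variable {ι κ : Type*} [Fintype ι] [DecidableEq ι] [Fintype κ]

/-- **(II.76), `K_{ρ,ρ₂}(A′, γ) = (det (ζUᵗʳU + Γ⁻¹)_ρ / Γ⁻¹)^{−1/2} ∫ dπ_{ρ₂}(γ″) e^{−Σ((λ_i^t)^{1/2+2ε₂}κ^i(γ′(γ″,γ)))^N}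
e^{−(ζ/2)[Σ+W+Ω]}`** in the finite-dimensional reading (FD): given the modified operator `Mρ = (ζUᵗʳU + Γ⁻¹)_ρ` of (II.75)
on the window coordinates (assumed to define a Gaussian `dπ`, as the print presupposes), the inverse propagator `Γ⁻¹`,
and the remaining integrand `G(γ″)` (damping × `e^{−(ζ/2)[Σ+W+Ω]}` in the variable `γ″`; a parameter here — READINGS
(Y) and §1–§3 for its typed pieces), `K_{ρ,ρ₂} = (det(Mρ Γ))^{−1/2} · ∫ dπ_{Mρ} G`, `Γ = (Γ⁻¹)⁻¹`.
[cite: MagnenRivasseauSeneor1993, (II.76) p.346 tl.10–12, (II.75) p.346] -/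
def Krr (Mρ Γinv : Matrix ι ι ℝ) (G : (ι → ℝ) → ℝ) : ℝ :=
  (Real.sqrt (Matrix.det (Mρ * Γinv⁻¹)))⁻¹ * gaussExpect Mρ G

/-- The print's two forms of the prefactor agree: `det((ζU² + Γ⁻¹)/Γ⁻¹) = det(1 + ζΓU²)` («(det (ζU²+Γ⁻¹)/Γ⁻¹)^{1/2} =
(det(1 + ζΓU²))^{1/2} which appears in K_{ρ₂}(A)⁻¹ is the analogue of the Fadeev-Popov determinant», p.345 tl.11–13),
reading the quotient as `(ζUᵀU + Γ⁻¹)Γ` and using `det(1 + AB) = det(1 + BA)`.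
[cite: MagnenRivasseauSeneor1993, p.345 tl.11–13] -/
theorem det_csMat_mul_propagator (ζ : ℝ) (U : Matrix κ ι ℝ) {Γinv : Matrix ι ι ℝ} (hΓ : IsUnit Γinv.det) :
    Matrix.det (csMat ζ U Γinv * Γinv⁻¹) = Matrix.det (1 + ζ • (Γinv⁻¹ * (Uᵀ * U))) := by
  unfold csMat
  rw [add_mul, Matrix.mul_nonsing_inv _ hΓ, add_comm, Matrix.det_one_add_mul_comm, Matrix.mul_smul]

/-- **At `κ_ρ ≡ 1`, `K_{ρ,ρ₂}` is the completed-square form (II.73) of `K_{ρ₂}(A′, γ)`**: with `Mρ = ζU² + Γ⁻¹` and the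
remaining integrand `G(γ″) = e^{Ω/2}·F(γ′(γ″,γ))`, `(det(MΓ))^{−1/2}∫dπ_M G = ∫dν_Γ(γ′)e^{−(ζ/2)(U(γ′−γ)+c)²}F(γ′)`
PROVIDED the normalisation ratio takes its Gaussian value `Z(M)/Z(Γ⁻¹) = (det(MΓ))^{−1/2}` (hypothesis `hZ`, DISCHARGED
in §6: `Krr_csMat_eq_of_posDef`). [cite: MagnenRivasseauSeneor1993, (II.73) p.345, (II.76) p.346] -/
theorem Krr_csMat_eq (ζ : ℝ) (U : Matrix κ ι ℝ) {Γinv : Matrix ι ι ℝ} (hΓ : Γinv.IsSymm)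
    (hM : IsUnit (csMat ζ U Γinv).det) (hZ0 : gaussZ (csMat ζ U Γinv) ≠ 0)
    (hZ : gaussZ (csMat ζ U Γinv) / gaussZ Γinv = (Real.sqrt (Matrix.det (csMat ζ U Γinv * Γinv⁻¹)))⁻¹)
    (c : κ → ℝ) (γ : ι → ℝ) (F : (ι → ℝ) → ℝ) :
    Krr (csMat ζ U Γinv) Γinv
        (fun y => Real.exp (Omega ζ U Γinv c γ / 2) * F (y + (γ - (csMat ζ U Γinv)⁻¹ *ᵥ csVec ζ U Γinv c γ))) =
      gaussExpect Γinv (fun γ' => Real.exp (-(ζ / 2) * ((U *ᵥ (γ' - γ) + c) ⬝ᵥ (U *ᵥ (γ' - γ) + c))) * F γ') := by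
  rw [gaussExpect_completing_square ζ U hΓ hM hZ0 c γ F, Krr, ← hZ]
  unfold gaussExpect
  have h : ∀ y : ι → ℝ, Real.exp (-(1 / 2 : ℝ) * (y ⬝ᵥ (csMat ζ U Γinv *ᵥ y))) *
      (Real.exp (Omega ζ U Γinv c γ / 2) * F (y + (γ - (csMat ζ U Γinv)⁻¹ *ᵥ csVec ζ U Γinv c γ))) =
      Real.exp (Omega ζ U Γinv c γ / 2) * (Real.exp (-(1 / 2 : ℝ) * (y ⬝ᵥ (csMat ζ U Γinv *ᵥ y))) *
        F (y + (γ - (csMat ζ U Γinv)⁻¹ *ᵥ csVec ζ U Γinv c γ))) := by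
    intro y; ring
  simp_rw [h]
  rw [integral_const_mul]
  ring

end GhostGaussian

/-! ## §6 The Gaussian normalisation `Z(Q) = (2π)^{n/2}(det Q)^{−1/2}` PROVED (finite dimensions) — hence the printed
prefactor `(det (ζU²+Γ⁻¹)/Γ⁻¹)^{−1/2}` of (II.73)/(II.76) is a THEOREM in READING (FD), not a hypothesis -/

namespace GhostGaussian

variable {ι κ : Type*} [Fintype ι] [DecidableEq ι] [Fintype κ]

open scoped MatrixOrder

/-- Linear change of variables on the window coordinates: `∫ g(Ly) dy = |det L|⁻¹ ∫ g` (Lebesgue measure on `ι → ℝ`,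
Mathlib `Real.map_linearMap_volume_pi_eq_smul_volume_pi`). [cite: MagnenRivasseauSeneor1993, (II.73) p.345 tl.9–13] -/
theorem integral_comp_mulVec (L : Matrix ι ι ℝ) (hL : L.det ≠ 0) {g : (ι → ℝ) → ℝ}
    (hg : AEStronglyMeasurable g volume) :
    ∫ y, g (L *ᵥ y) = |L.det|⁻¹ * ∫ y, g y := by
  classical
  have hf : LinearMap.det (Matrix.toLin' L) ≠ 0 := by rwa [LinearMap.det_toLin']
  have hmap := Real.map_linearMap_volume_pi_eq_smul_volume_pi hf
  have hφ : AEMeasurable (Matrix.toLin' L) volume :=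
    (Matrix.toLin' L).continuous_of_finiteDimensional.measurable.aemeasurable
  have hgm : AEStronglyMeasurable g (Measure.map (Matrix.toLin' L) volume) := by
    rw [hmap]; exact hg.smul_measure _
  have h1 : (fun y => g (L *ᵥ y)) = fun y => g (Matrix.toLin' L y) := by
    funext y; rw [Matrix.toLin'_apply]
  rw [h1, ← integral_map hφ hgm, hmap, integral_smul_measure, ENNReal.toReal_ofReal (abs_nonneg _),
    LinearMap.det_toLin', abs_inv, smul_eq_mul]

omit [DecidableEq ι] in
/-- The standard Gaussian integral over the window coordinates: `∫ e^{−½ z·z} dz = (2π)^{n/2}` (product of `n`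
one-dimensional Gaussian integrals). [cite: MagnenRivasseauSeneor1993, (II.73) p.345 tl.9–13] -/
theorem integral_exp_neg_half_dotProduct_self :
    ∫ z : ι → ℝ, Real.exp (-(1 / 2 : ℝ) * (z ⬝ᵥ z)) = Real.sqrt (2 * Real.pi) ^ Fintype.card ι := by
  have h : ∀ z : ι → ℝ, Real.exp (-(1 / 2 : ℝ) * (z ⬝ᵥ z)) = ∏ i, Real.exp (-(1 / 2 : ℝ) * z i ^ 2) := by
    intro z
    rw [← Real.exp_sum, dotProduct, Finset.mul_sum]
    congr 1
    exact Finset.sum_congr rfl fun i _ => by ring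
  simp_rw [h]
  rw [integral_fintype_prod_volume_eq_pow (fun t : ℝ => Real.exp (-(1 / 2 : ℝ) * t ^ 2)), integral_gaussian]
  congr 1
  congr 1
  ring

/-- **`Z(Q) = (2π)^{n/2}/√(det Q)` for positive-definite `Q`, PROVED**: write `Q = L²` with `L = √Q` (continuous functional
calculus, `Lᵀ = L`, `det L = √det Q`), change variables `y ↦ Ly`. This is the value behind the print's «(det
(ζU²+Γ⁻¹)/Γ⁻¹)^{−1/2}» and «up to the constant normalization det Γ⁻¹» (p.345 tl.9–17).
[cite: MagnenRivasseauSeneor1993, (II.73) p.345 tl.9–17] -/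
theorem gaussZ_eq {Q : Matrix ι ι ℝ} (hQ : Q.PosDef) :
    gaussZ Q = Real.sqrt (2 * Real.pi) ^ Fintype.card ι / Real.sqrt Q.det := by
  set L : Matrix ι ι ℝ := CFC.sqrt Q with hL
  have hLL : L * L = Q := CFC.sqrt_mul_sqrt_self Q hQ.posSemidef.nonneg
  have hLsa : Lᵀ = L := by
    have h := (CFC.sqrt_nonneg Q).isSelfAdjoint
    rw [IsSelfAdjoint, Matrix.star_eq_conjTranspose, Matrix.conjTranspose_eq_transpose_of_trivial] at h
    exact h
  have hLpsd : L.PosSemidef := Matrix.nonneg_iff_posSemidef.mp (CFC.sqrt_nonneg Q)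
  have hdetL : L.det = Real.sqrt Q.det := by
    have h1 : L.det * L.det = Q.det := by rw [← Matrix.det_mul, hLL]
    rw [← h1, Real.sqrt_mul_self hLpsd.det_nonneg]
  have hdetQ : 0 < Real.sqrt Q.det := Real.sqrt_pos.mpr hQ.det_pos
  have hdetL_ne : L.det ≠ 0 := by rw [hdetL]; exact hdetQ.ne'
  have hquad : ∀ y : ι → ℝ, y ⬝ᵥ (Q *ᵥ y) = (L *ᵥ y) ⬝ᵥ (L *ᵥ y) := by
    intro y
    rw [← hLL, ← Matrix.mulVec_mulVec, mulVec_dotProduct_eq_dotProduct_transpose_mulVec L y (L *ᵥ y), hLsa]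
  have hg : AEStronglyMeasurable (fun z : ι → ℝ => Real.exp (-(1 / 2 : ℝ) * (z ⬝ᵥ z))) volume :=
    (Real.continuous_exp.comp (continuous_const.mul (continuous_id.dotProduct continuous_id))).aestronglyMeasurable
  unfold gaussZ
  simp_rw [hquad]
  rw [integral_comp_mulVec L hdetL_ne hg, integral_exp_neg_half_dotProduct_self, hdetL, abs_of_pos hdetQ,
    inv_mul_eq_div]

/-- `Z(Q) > 0`. [cite: MagnenRivasseauSeneor1993, (II.73) p.345] -/
theorem gaussZ_pos {Q : Matrix ι ι ℝ} (hQ : Q.PosDef) : 0 < gaussZ Q := by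
  rw [gaussZ_eq hQ]
  exact div_pos (pow_pos (Real.sqrt_pos.mpr (by positivity)) _) (Real.sqrt_pos.mpr hQ.det_pos)

/-- **The printed prefactor, PROVED**: `Z(ζU²+Γ⁻¹)/Z(Γ⁻¹) = (det (ζU²+Γ⁻¹)/Γ⁻¹)^{−1/2}` for `ζ ≥ 0`, `Γ⁻¹ ≻ 0` — the
«(det (ζU²+Γ⁻¹)/Γ⁻¹)^{−1/2}» of (II.73) («the analogue of the Fadeev-Popov determinant (up to the constant normalization
det Γ⁻¹)», p.345 tl.14–17). [cite: MagnenRivasseauSeneor1993, (II.73) p.345 tl.9–17] -/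
theorem gaussZ_ratio {ζ : ℝ} (hζ : 0 ≤ ζ) (U : Matrix κ ι ℝ) {Γinv : Matrix ι ι ℝ} (hΓ : Γinv.PosDef) :
    gaussZ (csMat ζ U Γinv) / gaussZ Γinv = (Real.sqrt (Matrix.det (csMat ζ U Γinv * Γinv⁻¹)))⁻¹ := by
  have hM := posDef_csMat hζ U hΓ
  have h1 : 0 < (csMat ζ U Γinv).det := hM.det_pos
  have h2 : 0 < Γinv.det := hΓ.det_pos
  have hc : 0 < Real.sqrt (2 * Real.pi) ^ Fintype.card ι := pow_pos (Real.sqrt_pos.mpr (by positivity)) _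
  rw [gaussZ_eq hM, gaussZ_eq hΓ, Matrix.det_mul, Matrix.det_nonsing_inv, Ring.inverse_eq_inv,
    Real.sqrt_mul h1.le, Real.sqrt_inv]
  field_simp

/-- **(II.73) ⟺ (II.76) at `κ_ρ ≡ 1`, UNCONDITIONALLY in READING (FD)**: for `ζ ≥ 0` and `Γ⁻¹ ≻ 0`,
`K_{ρ,ρ₂}|_{κ_ρ≡1} = (det (ζU²+Γ⁻¹)/Γ⁻¹)^{−1/2} ∫dπ(γ″) e^{Ω/2}F(γ′(γ″,γ)) = ∫dν_Γ(γ′) e^{−(ζ/2)(U(γ′−γ)+c)²}F(γ′) =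
K_{ρ₂}(A′,γ)` — the normalisation hypotheses of `Krr_csMat_eq` discharged by `gaussZ_eq`.
[cite: MagnenRivasseauSeneor1993, (II.73) p.345, (II.76) p.346] -/
theorem Krr_csMat_eq_of_posDef {ζ : ℝ} (hζ : 0 ≤ ζ) (U : Matrix κ ι ℝ) {Γinv : Matrix ι ι ℝ} (hΓ : Γinv.PosDef)
    (c : κ → ℝ) (γ : ι → ℝ) (F : (ι → ℝ) → ℝ) :
    Krr (csMat ζ U Γinv) Γinv
        (fun y => Real.exp (Omega ζ U Γinv c γ / 2) * F (y + (γ - (csMat ζ U Γinv)⁻¹ *ᵥ csVec ζ U Γinv c γ))) =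
      gaussExpect Γinv (fun γ' => Real.exp (-(ζ / 2) * ((U *ᵥ (γ' - γ) + c) ⬝ᵥ (U *ᵥ (γ' - γ) + c))) * F γ') :=
  Krr_csMat_eq ζ U (isSymm_of_posDef hΓ) (isUnit_det_csMat hζ U hΓ) (gaussZ_pos (posDef_csMat hζ U hΓ)).ne'
    (gaussZ_ratio hζ U hΓ) c γ F

end GhostGaussian

end MainStatement

end Literature.MathematicalPhysics.QuantumFieldTheory.MagnenRivasseauSeneor1993
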